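import Literature.Analysis.FluidPDE.AsymBurgersUniformEnergy
import HarnessLib

/-!
# Angular smallness for `L + λM − αΛ` at large circulation: the multiplier `pχ∂_θu`

Analysis/FluidPDE file (all results proved, no definitions, no named facts). Notation as in
`AsymBurgersUniformEnergy`: `a = 1 − λ`, `p = e^{a|x|²/4}`, `u = w + Φψ`, `Λw = Ω∂_θu`,
`f = (L + λM)w − αΛw`; moreover `χ = (1 + |x|²)⁻¹` and `∂_θ = D(·)[x^⊥]`. Testing the equation
`αΛw = (L+λM)w − f` against `pχ ∂_θu` gives

  `α ∫ pχΩ (∂_θu)² = ∫ pχ ∂_θu (L+λM)w − ∫ pχ ∂_θu f`,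

and every term on the right is `O(∫ p w² + ∫ p f²)` uniformly in `α` (main theorem
`asymBurgers_angular_smallness`): the radial weight `pχ` commutes with `∂_θ`
(`∫ pχ w ∂_θw = 0`, `∫ pχ ∂ᵢw ∂_θ∂ᵢw = 0`), `χ` absorbs the linear growth of `x^⊥` and of the
drift, and the correction `Φ∂_θψ = −Φ⟪v, x⟫` is Gaussian. Hence `∫ pχΩ(∂_θu)² = O(1/|α|)`: the
non-radial part of `u` is small at large circulation (Maekawa 2009, Lemma 4.1 (4.2)–(4.3);
Gallay–Maekawa 2016, (4.9)).

## References

* Y. Maekawa, *Existence of asymmetric Burgers vortices and their asymptotic behavior at large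
  circulations*, Math. Models Methods Appl. Sci. 19 (2009), §4, Lemma 4.1, Prop. 4.2.
  [Maekawa2009b]
* Th. Gallay, Y. Maekawa, *Existence and stability of viscous vortices*, arXiv:1610.08384, §4.1
  (4.9). [GallayMaekawa2016]
-/

noncomputable section

open Set Function Filter MeasureTheory Metric Real
open scoped InnerProductSpace RealInnerProductSpace Topology Laplacian

namespace Literature.Analysis.FluidPDE

/-! ### The radial cut-off weight `pχ = e^{a|x|²/4} (1 + |x|²)⁻¹` -/

/-- `pχ` is `C¹`. [folklore] -/
theorem contDiff_gaussWeightChi (a : ℝ) :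
    ContDiff ℝ 1 (fun y : EuclideanSpace ℝ (Fin 2) => Real.exp (a / 4 * ‖y‖ ^ 2) * (1 + ‖y‖ ^ 2)⁻¹) :=
  (contDiff_gaussWeightExp a).mul ((contDiff_const.add (contDiff_norm_sq ℝ)).inv fun x => by positivity)

/-- `∂ᵢ(pχ)(x) = xᵢ (pχ)(x) (a/2 − 2χ(x))`. [folklore] -/
theorem fderiv_gaussWeightChi_single (a : ℝ) (x : EuclideanSpace ℝ (Fin 2)) (i : Fin 2) :
    fderiv ℝ (fun y : EuclideanSpace ℝ (Fin 2) => Real.exp (a / 4 * ‖y‖ ^ 2) * (1 + ‖y‖ ^ 2)⁻¹) x (EuclideanSpace.single i 1) =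
      x i * (Real.exp (a / 4 * ‖x‖ ^ 2) * (1 + ‖x‖ ^ 2)⁻¹) * (a / 2 - 2 * (1 + ‖x‖ ^ 2)⁻¹) := by
  have hn : HasFDerivAt (fun y : EuclideanSpace ℝ (Fin 2) => 1 + ‖y‖ ^ 2) ((2 : ℝ) • innerSL ℝ x) x := by
    have h := ((hasStrictFDerivAt_norm_sq x).hasFDerivAt).const_add 1
    refine h.congr_fderiv ?_
    ext v; simp [two_smul]
  have hpos : (1 + ‖x‖ ^ 2) ≠ 0 := by positivity
  have hinv : HasFDerivAt (fun y : EuclideanSpace ℝ (Fin 2) => (1 + ‖y‖ ^ 2)⁻¹)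
      ((-((1 + ‖x‖ ^ 2) ^ 2)⁻¹) • ((2 : ℝ) • innerSL ℝ x)) x :=
    (hasDerivAt_inv hpos).comp_hasFDerivAt x hn
  have hP := hasFDerivAt_gaussWeightExp a x
  rw [(hP.fun_mul hinv).fderiv]
  simp only [_root_.add_apply, _root_.smul_apply, smul_eq_mul, innerSL_apply_apply,
    EuclideanSpace.inner_single_right, conj_trivial, one_mul]
  field_simp
  ring

/-- `|∂ᵢ(pχ)| ≤ (a/2 + 2) |xᵢ| pχ` for `a ≥ 0`. [folklore] -/
theorem abs_fderiv_gaussWeightChi_single_le {a : ℝ} (ha : 0 ≤ a) (x : EuclideanSpace ℝ (Fin 2)) (i : Fin 2) :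
    |fderiv ℝ (fun y : EuclideanSpace ℝ (Fin 2) => Real.exp (a / 4 * ‖y‖ ^ 2) * (1 + ‖y‖ ^ 2)⁻¹) x (EuclideanSpace.single i 1)| ≤
      (a / 2 + 2) * |x i| * (Real.exp (a / 4 * ‖x‖ ^ 2) * (1 + ‖x‖ ^ 2)⁻¹) := by
  rw [fderiv_gaussWeightChi_single, abs_mul, abs_mul, abs_of_pos (by positivity :
    (0:ℝ) < Real.exp (a / 4 * ‖x‖ ^ 2) * (1 + ‖x‖ ^ 2)⁻¹)]
  have hχ0 : 0 < (1 + ‖x‖ ^ 2)⁻¹ := by positivity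
  have hχ1 : (1 + ‖x‖ ^ 2)⁻¹ ≤ 1 := inv_le_one_of_one_le₀ (by nlinarith [norm_nonneg x])
  have hb : |a / 2 - 2 * (1 + ‖x‖ ^ 2)⁻¹| ≤ a / 2 + 2 := by
    rw [abs_le]; constructor <;> nlinarith
  calc |x i| * (Real.exp (a / 4 * ‖x‖ ^ 2) * (1 + ‖x‖ ^ 2)⁻¹) * |a / 2 - 2 * (1 + ‖x‖ ^ 2)⁻¹|
      ≤ |x i| * (Real.exp (a / 4 * ‖x‖ ^ 2) * (1 + ‖x‖ ^ 2)⁻¹) * (a / 2 + 2) := by gcongr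
    _ = _ := by ring

/-- `pχ` is radial: `∂_θ(pχ) = 0`. [folklore] -/
theorem fderiv_gaussWeightChi_perp (a : ℝ) (x : EuclideanSpace ℝ (Fin 2)) :
    fderiv ℝ (fun y : EuclideanSpace ℝ (Fin 2) => Real.exp (a / 4 * ‖y‖ ^ 2) * (1 + ‖y‖ ^ 2)⁻¹) x (perp x) = 0 := by
  have h : (fun y : EuclideanSpace ℝ (Fin 2) => Real.exp (a / 4 * ‖y‖ ^ 2) * (1 + ‖y‖ ^ 2)⁻¹) = fun y => (fun t : ℝ => Real.exp (a / 4 * t) * (1 + t)⁻¹) (‖y‖ ^ 2) := rfl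
  rw [h]
  have h1 : DifferentiableAt ℝ (fun t : ℝ => Real.exp (a / 4 * t)) (‖x‖ ^ 2) := by fun_prop
  have h2 : DifferentiableAt ℝ (fun t : ℝ => (1 + t)⁻¹) (‖x‖ ^ 2) :=
    ((differentiableAt_const _).add differentiableAt_id).inv (by positivity)
  exact fderiv_perp_eq_zero_of_radial (F := fun t : ℝ => Real.exp (a / 4 * t) * (1 + t)⁻¹) (h1.mul h2)

/-- Elementary facts on `χ = (1 + |x|²)⁻¹`: `0 < χ ≤ 1`, `χ|x|² ≤ 1`, `χ|x| ≤ 1`. [folklore] -/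
theorem chi_bounds (x : EuclideanSpace ℝ (Fin 2)) :
    0 < (1 + ‖x‖ ^ 2)⁻¹ ∧ (1 + ‖x‖ ^ 2)⁻¹ ≤ 1 ∧ (1 + ‖x‖ ^ 2)⁻¹ * ‖x‖ ^ 2 ≤ 1 ∧
      (1 + ‖x‖ ^ 2)⁻¹ * ‖x‖ ≤ 1 := by
  have hr := norm_nonneg x
  have h1 : (1:ℝ) ≤ 1 + ‖x‖ ^ 2 := by nlinarith
  have hpos : (0:ℝ) < 1 + ‖x‖ ^ 2 := by positivity
  refine ⟨by positivity, inv_le_one_of_one_le₀ h1, ?_, ?_⟩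
  · rw [inv_mul_le_iff₀ hpos]; nlinarith
  · rw [inv_mul_le_iff₀ hpos]; nlinarith [sq_nonneg (‖x‖ - 1)]

/-! ### Second derivatives: mixed partials and the angular derivative of `∂ᵢw` -/

section Second

variable {w : EuclideanSpace ℝ (Fin 2) → ℝ} (hw : ContDiff ℝ 2 w)
include hw

/-- `∂ⱼ∂ᵢw = D²w[eⱼ][eᵢ]`. [folklore] -/
theorem fderiv_fderiv_apply_eq_of_contDiff_two (x u v : EuclideanSpace ℝ (Fin 2)) :
    fderiv ℝ (fun y => fderiv ℝ w y u) x v = fderiv ℝ (fderiv ℝ w) x v u := by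
  have hd : DifferentiableAt ℝ (fderiv ℝ w) x :=
    ((hw.fderiv_right (m := 1) (by norm_num)).differentiable one_ne_zero).differentiableAt
  rw [fderiv_clm_apply hd (differentiableAt_const u)]
  simp

/-- **Mixed partials commute** for `w ∈ C²`: `∂₁∂₀w = ∂₀∂₁w`. [folklore] -/
theorem fderiv_fderiv_symm_of_contDiff_two (x u v : EuclideanSpace ℝ (Fin 2)) :
    fderiv ℝ (fun y => fderiv ℝ w y u) x v = fderiv ℝ (fun y => fderiv ℝ w y v) x u := by
  rw [fderiv_fderiv_apply_eq_of_contDiff_two hw, fderiv_fderiv_apply_eq_of_contDiff_two hw]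
  exact ((hw.contDiffAt (x := x)).isSymmSndFDerivAt (by simp)).eq _ _

/-- **`∇(∂_θw)·∇w = Σᵢ ∂ᵢw ∂_θ(∂ᵢw)`** pointwise, for `w ∈ C²` (uses the symmetry of `D²w` and
`⟪∇w, (∇w)^⊥⟫ = 0`). [folklore] -/
theorem sum_fderiv_angular_mul_fderiv_eq (x : EuclideanSpace ℝ (Fin 2)) :
    fderiv ℝ (fun y : EuclideanSpace ℝ (Fin 2) => fderiv ℝ w y (perp y)) x (EuclideanSpace.single 0 1) * fderiv ℝ w x (EuclideanSpace.single 0 1) +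
      fderiv ℝ (fun y : EuclideanSpace ℝ (Fin 2) => fderiv ℝ w y (perp y)) x (EuclideanSpace.single 1 1) * fderiv ℝ w x (EuclideanSpace.single 1 1) =
      fderiv ℝ w x (EuclideanSpace.single 0 1) * fderiv ℝ (fun y => fderiv ℝ w y (EuclideanSpace.single 0 1)) x (perp x) + fderiv ℝ w x (EuclideanSpace.single 1 1) * fderiv ℝ (fun y => fderiv ℝ w y (EuclideanSpace.single 1 1)) x (perp x) := by
  have hw1 : ContDiff ℝ 1 w := hw.of_le one_le_two
  -- `∂_θw = −x₁ ∂₀w + x₀ ∂₁w`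
  have hθ : (fun y : EuclideanSpace ℝ (Fin 2) => fderiv ℝ w y (perp y)) = fun y => -(y 1 * fderiv ℝ w y (EuclideanSpace.single 0 1)) + y 0 * fderiv ℝ w y (EuclideanSpace.single 1 1) := by
    funext y; rw [fderiv_perp_eq_coord]
  have hdi : ∀ i : Fin 2, ContDiff ℝ 1 (fun y => fderiv ℝ w y (EuclideanSpace.single i 1)) := fun i =>
    (hw.fderiv_right (m := 1) (by norm_num)).clm_apply contDiff_const
  have hpj : ∀ j : Fin 2, HasFDerivAt (fun y : EuclideanSpace ℝ (Fin 2) => y j) (EuclideanSpace.proj j : EuclideanSpace ℝ (Fin 2) →L[ℝ] ℝ) x :=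
    fun j => (EuclideanSpace.proj (j : Fin 2) : EuclideanSpace ℝ (Fin 2) →L[ℝ] ℝ).hasFDerivAt
  have hdd : ∀ i : Fin 2, HasFDerivAt (fun y => fderiv ℝ w y (EuclideanSpace.single i 1)) (fderiv ℝ (fun y => fderiv ℝ w y (EuclideanSpace.single i 1)) x) x := fun i =>
    ((hdi i).differentiable one_ne_zero x).hasFDerivAt
  have hθd : HasFDerivAt (fun y : EuclideanSpace ℝ (Fin 2) => -(y 1 * fderiv ℝ w y (EuclideanSpace.single 0 1)) + y 0 * fderiv ℝ w y (EuclideanSpace.single 1 1))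
      (-(x 1 • fderiv ℝ (fun y => fderiv ℝ w y (EuclideanSpace.single 0 1)) x + fderiv ℝ w x (EuclideanSpace.single 0 1) • (EuclideanSpace.proj 1 : EuclideanSpace ℝ (Fin 2) →L[ℝ] ℝ)) +
        (x 0 • fderiv ℝ (fun y => fderiv ℝ w y (EuclideanSpace.single 1 1)) x + fderiv ℝ w x (EuclideanSpace.single 1 1) • (EuclideanSpace.proj 0 : EuclideanSpace ℝ (Fin 2) →L[ℝ] ℝ))) x :=
    ((hpj 1).mul (hdd 0)).neg.add ((hpj 0).mul (hdd 1))
  rw [hθ, hθd.fderiv]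
  have hsymm := fderiv_fderiv_symm_of_contDiff_two hw x (EuclideanSpace.single 0 1) (EuclideanSpace.single 1 1)
  rw [fderiv_perp_eq_coord (fun y => fderiv ℝ w y (EuclideanSpace.single 0 1)) x, fderiv_perp_eq_coord (fun y => fderiv ℝ w y (EuclideanSpace.single 1 1)) x]
  simp only [_root_.add_apply, _root_.neg_apply, _root_.smul_apply, smul_eq_mul]
  simp [hsymm]
  ring

end Second

/-! ### The `w`-part of the multiplier: `∫ pχ ∂_θw (L + λM)w = O(∫ p|∇w|²)` -/

/-- Continuous times continuous-compactly-supported is integrable. [folklore] -/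
private theorem integrable_mul_of_hasCompactSupport' {f g : EuclideanSpace ℝ (Fin 2) → ℝ}
    (hf : Continuous f) (hg : Continuous g) (hgc : HasCompactSupport g) :
    Integrable fun x => f x * g x :=
  (hf.mul hg).integrable_of_hasCompactSupport hgc.mul_left

/-- The Laplacian on `ℝ²` in coordinates for a `C²` function (private copy, see
`AsymBurgersUniformEnergy`). [folklore] -/
private theorem laplacian_eq_fin_two_of_contDiff_two'' {φ : EuclideanSpace ℝ (Fin 2) → ℝ}
    (hφ : ContDiff ℝ 2 φ) (x : EuclideanSpace ℝ (Fin 2)) :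
    Δ φ x = fderiv ℝ (fun y => fderiv ℝ φ y (EuclideanSpace.single 0 (1 : ℝ))) x
        (EuclideanSpace.single 0 (1 : ℝ)) +
      fderiv ℝ (fun y => fderiv ℝ φ y (EuclideanSpace.single 1 (1 : ℝ))) x
        (EuclideanSpace.single 1 (1 : ℝ)) := by
  have hd : DifferentiableAt ℝ (fderiv ℝ φ) x :=
    ((hφ.fderiv_right (m := 1) (by norm_num)).differentiable one_ne_zero).differentiableAt
  have hkey : ∀ v : EuclideanSpace ℝ (Fin 2),
      fderiv ℝ (fun y => fderiv ℝ φ y v) x v = fderiv ℝ (fderiv ℝ φ) x v v := by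
    intro v
    rw [fderiv_clm_apply hd (differentiableAt_const v)]
    simp
  rw [InnerProductSpace.laplacian_eq_iteratedFDeriv_orthonormalBasis φ
    (EuclideanSpace.basisFun (Fin 2) ℝ)]
  simp only [Fin.sum_univ_two, EuclideanSpace.basisFun_apply, iteratedFDeriv_two_apply, hkey]
  rfl

section WPart

variable {w : EuclideanSpace ℝ (Fin 2) → ℝ} (hw : ContDiff ℝ 2 w) (hwc : HasCompactSupport w) {a : ℝ} (ha : 0 ≤ a)
include hw hwc

omit hwc in
/-- `∂_θw` is `C¹` for `w ∈ C²`. [folklore] -/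
theorem contDiff_one_angular : ContDiff ℝ 1 (fun y : EuclideanSpace ℝ (Fin 2) => fderiv ℝ w y (perp y)) := by
  have hθ : (fun y : EuclideanSpace ℝ (Fin 2) => fderiv ℝ w y (perp y)) = fun y => -(y 1 * fderiv ℝ w y (EuclideanSpace.single 0 1)) + y 0 * fderiv ℝ w y (EuclideanSpace.single 1 1) := by
    funext y; rw [fderiv_perp_eq_coord]
  have hdi : ∀ i : Fin 2, ContDiff ℝ 1 (fun y => fderiv ℝ w y (EuclideanSpace.single i 1)) := fun i =>
    (hw.fderiv_right (m := 1) (by norm_num)).clm_apply contDiff_const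
  have hpj : ∀ j : Fin 2, ContDiff ℝ 1 fun y : EuclideanSpace ℝ (Fin 2) => y j := fun j =>
    (EuclideanSpace.proj (j : Fin 2) : EuclideanSpace ℝ (Fin 2) →L[ℝ] ℝ).contDiff
  rw [hθ]
  exact ((hpj 1).mul (hdi 0)).neg.add ((hpj 0).mul (hdi 1))

omit hw hwc in
/-- `|∂_θw| ≤ |x| (|∂₀w| + |∂₁w|)`. [folklore] -/
theorem abs_angular_le (x : EuclideanSpace ℝ (Fin 2)) : |fderiv ℝ w x (perp x)| ≤ ‖x‖ * (|fderiv ℝ w x (EuclideanSpace.single 0 1)| + |fderiv ℝ w x (EuclideanSpace.single 1 1)|) := by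
  rw [fderiv_perp_eq_coord]
  have h0 : |x 0| ≤ ‖x‖ := by simpa using PiLp.norm_apply_le x 0
  have h1 : |x 1| ≤ ‖x‖ := by simpa using PiLp.norm_apply_le x 1
  calc |-(x 1 * fderiv ℝ w x (EuclideanSpace.single 0 1)) + x 0 * fderiv ℝ w x (EuclideanSpace.single 1 1)|
      ≤ |-(x 1 * fderiv ℝ w x (EuclideanSpace.single 0 1))| + |x 0 * fderiv ℝ w x (EuclideanSpace.single 1 1)| := abs_add_le _ _
    _ = |x 1| * |fderiv ℝ w x (EuclideanSpace.single 0 1)| + |x 0| * |fderiv ℝ w x (EuclideanSpace.single 1 1)| := by rw [abs_neg, abs_mul, abs_mul]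
    _ ≤ ‖x‖ * |fderiv ℝ w x (EuclideanSpace.single 0 1)| + ‖x‖ * |fderiv ℝ w x (EuclideanSpace.single 1 1)| := by gcongr
    _ = _ := by ring

/-- **`Σᵢ ∫ pχ ∂ᵢ(∂_θw) ∂ᵢw = 0`**: by `∇(∂_θw)·∇w = Σᵢ ∂ᵢw ∂_θ(∂ᵢw)` and the skew-symmetry of
`∂_θ` against the radial weight `pχ`. [folklore] -/
theorem integral_gaussWeightChi_mul_sum_fderiv_angular_eq_zero :
    ∫ x, (Real.exp (a / 4 * ‖x‖ ^ 2) * (1 + ‖x‖ ^ 2)⁻¹) * (fderiv ℝ (fun y : EuclideanSpace ℝ (Fin 2) => fderiv ℝ w y (perp y)) x (EuclideanSpace.single 0 1) * fderiv ℝ w x (EuclideanSpace.single 0 1) +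
      fderiv ℝ (fun y : EuclideanSpace ℝ (Fin 2) => fderiv ℝ w y (perp y)) x (EuclideanSpace.single 1 1) * fderiv ℝ w x (EuclideanSpace.single 1 1)) = 0 := by
  have hw1 : ContDiff ℝ 1 w := hw.of_le one_le_two
  have hdi : ∀ i : Fin 2, ContDiff ℝ 1 (fun y => fderiv ℝ w y (EuclideanSpace.single i 1)) := fun i =>
    (hw.fderiv_right (m := 1) (by norm_num)).clm_apply contDiff_const
  have hds : ∀ i : Fin 2, HasCompactSupport (fun y => fderiv ℝ w y (EuclideanSpace.single i 1)) := fun i => hwc.fderiv_apply (𝕜 := ℝ) _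
  have hF := contDiff_gaussWeightChi a
  have hFc := hF.continuous
  -- the two skew integrals vanish
  have hzero : ∀ i : Fin 2, ∫ x, (Real.exp (a / 4 * ‖x‖ ^ 2) * (1 + ‖x‖ ^ 2)⁻¹) * fderiv ℝ w x (EuclideanSpace.single i 1) * fderiv ℝ (fun y => fderiv ℝ w y (EuclideanSpace.single i 1)) x (perp x) = 0 := by
    intro i
    have hg := hdi i
    have hgc := hg.continuous
    have hg'c : Continuous fun x => fderiv ℝ (fun y => fderiv ℝ w y (EuclideanSpace.single i 1)) x := hg.continuous_fderiv one_ne_zero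
    have hFg := hF.mul hg
    have hFg'c : Continuous fun x => fderiv ℝ (fun y => (fun y : EuclideanSpace ℝ (Fin 2) => Real.exp (a / 4 * ‖y‖ ^ 2) * (1 + ‖y‖ ^ 2)⁻¹) y * (fun y => fderiv ℝ w y (EuclideanSpace.single i 1)) y) x :=
      hFg.continuous_fderiv one_ne_zero
    have hs1 : HasCompactSupport fun x : EuclideanSpace ℝ (Fin 2) => |(fun y => fderiv ℝ w y (EuclideanSpace.single i 1)) x| := (hds i).norm
    have hs2 : HasCompactSupport fun x : EuclideanSpace ℝ (Fin 2) => |(fun y : EuclideanSpace ℝ (Fin 2) => Real.exp (a / 4 * ‖y‖ ^ 2) * (1 + ‖y‖ ^ 2)⁻¹) x * (fun y => fderiv ℝ w y (EuclideanSpace.single i 1)) x| := ((hds i).mul_left).norm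
    refine integral_mul_mul_fderiv_perp_eq_zero hF hg (fderiv_gaussWeightChi_perp a) ?_ ?_ ?_
    · exact (continuous_norm.mul (((hFc.mul hgc).abs).mul hgc.abs)).integrable_of_hasCompactSupport
        (hs1.mul_left.mul_left)
    · exact (continuous_norm.mul (((hFc.mul hgc).abs).mul hg'c.norm)).integrable_of_hasCompactSupport
        (hs2.mul_right.mul_left)
    · exact (continuous_norm.mul (hFg'c.norm.mul hgc.abs)).integrable_of_hasCompactSupport
        (hs1.mul_left.mul_left)
  -- rewrite the integrand pointwise and split
  have hpt : ∀ x : EuclideanSpace ℝ (Fin 2), (Real.exp (a / 4 * ‖x‖ ^ 2) * (1 + ‖x‖ ^ 2)⁻¹) * (fderiv ℝ (fun y : EuclideanSpace ℝ (Fin 2) => fderiv ℝ w y (perp y)) x (EuclideanSpace.single 0 1) * fderiv ℝ w x (EuclideanSpace.single 0 1) +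
      fderiv ℝ (fun y : EuclideanSpace ℝ (Fin 2) => fderiv ℝ w y (perp y)) x (EuclideanSpace.single 1 1) * fderiv ℝ w x (EuclideanSpace.single 1 1)) =
      (Real.exp (a / 4 * ‖x‖ ^ 2) * (1 + ‖x‖ ^ 2)⁻¹) * fderiv ℝ w x (EuclideanSpace.single 0 1) * fderiv ℝ (fun y => fderiv ℝ w y (EuclideanSpace.single 0 1)) x (perp x) +
      (Real.exp (a / 4 * ‖x‖ ^ 2) * (1 + ‖x‖ ^ 2)⁻¹) * fderiv ℝ w x (EuclideanSpace.single 1 1) * fderiv ℝ (fun y => fderiv ℝ w y (EuclideanSpace.single 1 1)) x (perp x) := by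
    intro x; rw [sum_fderiv_angular_mul_fderiv_eq hw x]; ring
  have hint : ∀ i : Fin 2, Integrable fun x => (Real.exp (a / 4 * ‖x‖ ^ 2) * (1 + ‖x‖ ^ 2)⁻¹) * fderiv ℝ w x (EuclideanSpace.single i 1) * fderiv ℝ (fun y => fderiv ℝ w y (EuclideanSpace.single i 1)) x (perp x) := by
    intro i
    have hθc : Continuous fun x => fderiv ℝ (fun y => fderiv ℝ w y (EuclideanSpace.single i 1)) x (perp x) :=
      ((hdi i).continuous_fderiv one_ne_zero).clm_apply continuous_perp
    have : Integrable fun x => (Real.exp (a / 4 * ‖x‖ ^ 2) * (1 + ‖x‖ ^ 2)⁻¹) * fderiv ℝ (fun y => fderiv ℝ w y (EuclideanSpace.single i 1)) x (perp x) * fderiv ℝ w x (EuclideanSpace.single i 1) :=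
      integrable_mul_of_hasCompactSupport' (hFc.mul hθc) (hdi i).continuous (hds i)
    exact this.congr (Eventually.of_forall fun x => by beta_reduce; ring)
  simp_rw [hpt]
  rw [integral_add (hint 0) (hint 1), hzero 0, hzero 1, add_zero]

/-- **Integration by parts of `∫ pχ ∂_θw Δw`**:
`∫ pχ ∂_θw Δw = −Σᵢ ∫ ∂ᵢ(pχ) ∂_θw ∂ᵢw` (the term `Σᵢ∫ pχ ∂ᵢ(∂_θw)∂ᵢw` vanishes). [folklore] -/
theorem integral_gaussWeightChi_angular_mul_laplacian_eq :
    ∫ x, (Real.exp (a / 4 * ‖x‖ ^ 2) * (1 + ‖x‖ ^ 2)⁻¹) * fderiv ℝ w x (perp x) * Δ w x =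
      -∫ x, fderiv ℝ (fun y : EuclideanSpace ℝ (Fin 2) => Real.exp (a / 4 * ‖y‖ ^ 2) * (1 + ‖y‖ ^ 2)⁻¹) x (EuclideanSpace.single 0 1) * fderiv ℝ w x (perp x) * fderiv ℝ w x (EuclideanSpace.single 0 1) +
        fderiv ℝ (fun y : EuclideanSpace ℝ (Fin 2) => Real.exp (a / 4 * ‖y‖ ^ 2) * (1 + ‖y‖ ^ 2)⁻¹) x (EuclideanSpace.single 1 1) * fderiv ℝ w x (perp x) * fderiv ℝ w x (EuclideanSpace.single 1 1) := by
  have hw1 : ContDiff ℝ 1 w := hw.of_le one_le_two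
  have hdi : ∀ i : Fin 2, ContDiff ℝ 1 (fun y => fderiv ℝ w y (EuclideanSpace.single i 1)) := fun i =>
    (hw.fderiv_right (m := 1) (by norm_num)).clm_apply contDiff_const
  have hds : ∀ i : Fin 2, HasCompactSupport (fun y => fderiv ℝ w y (EuclideanSpace.single i 1)) := fun i => hwc.fderiv_apply (𝕜 := ℝ) _
  have hdds : ∀ i : Fin 2, HasCompactSupport fun x => fderiv ℝ (fun y => fderiv ℝ w y (EuclideanSpace.single i 1)) x (EuclideanSpace.single i 1) := fun i =>
    (hds i).fderiv_apply (𝕜 := ℝ) _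
  have hF := contDiff_gaussWeightChi a
  have hθ := contDiff_one_angular hw
  have hf : ContDiff ℝ 1 fun y => (fun y : EuclideanSpace ℝ (Fin 2) => Real.exp (a / 4 * ‖y‖ ^ 2) * (1 + ‖y‖ ^ 2)⁻¹) y * (fun y : EuclideanSpace ℝ (Fin 2) => fderiv ℝ w y (perp y)) y := hF.mul hθ
  have hfc := hf.continuous
  have hf'c : ∀ v : EuclideanSpace ℝ (Fin 2), Continuous fun x => fderiv ℝ (fun y => (fun y : EuclideanSpace ℝ (Fin 2) => Real.exp (a / 4 * ‖y‖ ^ 2) * (1 + ‖y‖ ^ 2)⁻¹) y * (fun y : EuclideanSpace ℝ (Fin 2) => fderiv ℝ w y (perp y)) y) x v := fun v =>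
    (hf.continuous_fderiv one_ne_zero).clm_apply continuous_const
  have hgc : ∀ i : Fin 2, Continuous (fun y => fderiv ℝ w y (EuclideanSpace.single i 1)) := fun i => (hdi i).continuous
  have hg'c : ∀ i : Fin 2, Continuous fun x => fderiv ℝ (fun y => fderiv ℝ w y (EuclideanSpace.single i 1)) x (EuclideanSpace.single i 1) := fun i =>
    ((hdi i).continuous_fderiv one_ne_zero).clm_apply continuous_const
  -- IBP for each `i`
  have hibp : ∀ i : Fin 2, ∫ x, (fun y : EuclideanSpace ℝ (Fin 2) => Real.exp (a / 4 * ‖y‖ ^ 2) * (1 + ‖y‖ ^ 2)⁻¹) x * (fun y : EuclideanSpace ℝ (Fin 2) => fderiv ℝ w y (perp y)) x * fderiv ℝ (fun y => fderiv ℝ w y (EuclideanSpace.single i 1)) x (EuclideanSpace.single i 1) =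
      -∫ x, fderiv ℝ (fun y => (fun y : EuclideanSpace ℝ (Fin 2) => Real.exp (a / 4 * ‖y‖ ^ 2) * (1 + ‖y‖ ^ 2)⁻¹) y * (fun y : EuclideanSpace ℝ (Fin 2) => fderiv ℝ w y (perp y)) y) x (EuclideanSpace.single i 1) * fderiv ℝ w x (EuclideanSpace.single i 1) := by
    intro i
    exact integral_mul_fderiv_eq_neg_fderiv_mul_of_integrable (μ := volume)
      (v := EuclideanSpace.single i 1)
      (integrable_mul_of_hasCompactSupport' (hf'c _) (hgc i) (hds i))
      (integrable_mul_of_hasCompactSupport' hfc (hg'c i) (hdds i))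
      (integrable_mul_of_hasCompactSupport' hfc (hgc i) (hds i))
      (fun x _ => (hf.differentiable one_ne_zero) x) (fun x _ => ((hdi i).differentiable one_ne_zero) x)
  -- the derivative of the product
  have hprod : ∀ (x : EuclideanSpace ℝ (Fin 2)) (i : Fin 2), fderiv ℝ (fun y => (fun y : EuclideanSpace ℝ (Fin 2) => Real.exp (a / 4 * ‖y‖ ^ 2) * (1 + ‖y‖ ^ 2)⁻¹) y * (fun y : EuclideanSpace ℝ (Fin 2) => fderiv ℝ w y (perp y)) y) x (EuclideanSpace.single i 1) =
      fderiv ℝ (fun y : EuclideanSpace ℝ (Fin 2) => Real.exp (a / 4 * ‖y‖ ^ 2) * (1 + ‖y‖ ^ 2)⁻¹) x (EuclideanSpace.single i 1) * fderiv ℝ w x (perp x) +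
      (Real.exp (a / 4 * ‖x‖ ^ 2) * (1 + ‖x‖ ^ 2)⁻¹) * fderiv ℝ (fun y : EuclideanSpace ℝ (Fin 2) => fderiv ℝ w y (perp y)) x (EuclideanSpace.single i 1) := by
    intro x i
    have h1 : HasFDerivAt (fun y : EuclideanSpace ℝ (Fin 2) => Real.exp (a / 4 * ‖y‖ ^ 2) * (1 + ‖y‖ ^ 2)⁻¹) (fderiv ℝ (fun y : EuclideanSpace ℝ (Fin 2) => Real.exp (a / 4 * ‖y‖ ^ 2) * (1 + ‖y‖ ^ 2)⁻¹) x) x := ((hF.differentiable one_ne_zero) x).hasFDerivAt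
    have h2 : HasFDerivAt (fun y : EuclideanSpace ℝ (Fin 2) => fderiv ℝ w y (perp y)) (fderiv ℝ (fun y : EuclideanSpace ℝ (Fin 2) => fderiv ℝ w y (perp y)) x) x := ((hθ.differentiable one_ne_zero) x).hasFDerivAt
    rw [(h1.fun_mul h2).fderiv]
    simp only [_root_.add_apply, _root_.smul_apply, smul_eq_mul]
    ring
  -- assemble
  have hΔ : ∀ x, Δ w x = fderiv ℝ (fun y => fderiv ℝ w y (EuclideanSpace.single 0 1)) x (EuclideanSpace.single 0 1) + fderiv ℝ (fun y => fderiv ℝ w y (EuclideanSpace.single 1 1)) x (EuclideanSpace.single 1 1) := laplacian_eq_fin_two_of_contDiff_two'' hw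
  have hL : ∫ x, (Real.exp (a / 4 * ‖x‖ ^ 2) * (1 + ‖x‖ ^ 2)⁻¹) * fderiv ℝ w x (perp x) * Δ w x = (∫ x, (fun y : EuclideanSpace ℝ (Fin 2) => Real.exp (a / 4 * ‖y‖ ^ 2) * (1 + ‖y‖ ^ 2)⁻¹) x * (fun y : EuclideanSpace ℝ (Fin 2) => fderiv ℝ w y (perp y)) x * fderiv ℝ (fun y => fderiv ℝ w y (EuclideanSpace.single 0 1)) x (EuclideanSpace.single 0 1)) +
      ∫ x, (fun y : EuclideanSpace ℝ (Fin 2) => Real.exp (a / 4 * ‖y‖ ^ 2) * (1 + ‖y‖ ^ 2)⁻¹) x * (fun y : EuclideanSpace ℝ (Fin 2) => fderiv ℝ w y (perp y)) x * fderiv ℝ (fun y => fderiv ℝ w y (EuclideanSpace.single 1 1)) x (EuclideanSpace.single 1 1) := by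
    rw [← integral_add (integrable_mul_of_hasCompactSupport' hfc (hg'c 0) (hdds 0))
      (integrable_mul_of_hasCompactSupport' hfc (hg'c 1) (hdds 1))]
    refine integral_congr_ae (Eventually.of_forall fun x => ?_)
    simp only [hΔ x]
    ring
  have i1 : ∀ i : Fin 2, Integrable fun x => fderiv ℝ (fun y : EuclideanSpace ℝ (Fin 2) => Real.exp (a / 4 * ‖y‖ ^ 2) * (1 + ‖y‖ ^ 2)⁻¹) x (EuclideanSpace.single i 1) * fderiv ℝ w x (perp x) * fderiv ℝ w x (EuclideanSpace.single i 1) := by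
    intro i
    have hc : Continuous fun x => fderiv ℝ (fun y : EuclideanSpace ℝ (Fin 2) => Real.exp (a / 4 * ‖y‖ ^ 2) * (1 + ‖y‖ ^ 2)⁻¹) x (EuclideanSpace.single i 1) :=
      (hF.continuous_fderiv one_ne_zero).clm_apply continuous_const
    exact integrable_mul_of_hasCompactSupport' (hc.mul hθ.continuous) (hgc i) (hds i)
  have i2 : ∀ i : Fin 2, Integrable fun x => (Real.exp (a / 4 * ‖x‖ ^ 2) * (1 + ‖x‖ ^ 2)⁻¹) * fderiv ℝ (fun y : EuclideanSpace ℝ (Fin 2) => fderiv ℝ w y (perp y)) x (EuclideanSpace.single i 1) * fderiv ℝ w x (EuclideanSpace.single i 1) := by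
    intro i
    have hc : Continuous fun x => fderiv ℝ (fun y : EuclideanSpace ℝ (Fin 2) => fderiv ℝ w y (perp y)) x (EuclideanSpace.single i 1) :=
      (hθ.continuous_fderiv one_ne_zero).clm_apply continuous_const
    exact integrable_mul_of_hasCompactSupport' (hF.continuous.mul hc) (hgc i) (hds i)
  have hsplit : ∀ i : Fin 2, ∫ x, fderiv ℝ (fun y => (fun y : EuclideanSpace ℝ (Fin 2) => Real.exp (a / 4 * ‖y‖ ^ 2) * (1 + ‖y‖ ^ 2)⁻¹) y * (fun y : EuclideanSpace ℝ (Fin 2) => fderiv ℝ w y (perp y)) y) x (EuclideanSpace.single i 1) * fderiv ℝ w x (EuclideanSpace.single i 1) =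
      (∫ x, fderiv ℝ (fun y : EuclideanSpace ℝ (Fin 2) => Real.exp (a / 4 * ‖y‖ ^ 2) * (1 + ‖y‖ ^ 2)⁻¹) x (EuclideanSpace.single i 1) * fderiv ℝ w x (perp x) * fderiv ℝ w x (EuclideanSpace.single i 1)) +
      ∫ x, (Real.exp (a / 4 * ‖x‖ ^ 2) * (1 + ‖x‖ ^ 2)⁻¹) * fderiv ℝ (fun y : EuclideanSpace ℝ (Fin 2) => fderiv ℝ w y (perp y)) x (EuclideanSpace.single i 1) * fderiv ℝ w x (EuclideanSpace.single i 1) := by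
    intro i
    rw [← integral_add (i1 i) (i2 i)]
    refine integral_congr_ae (Eventually.of_forall fun x => ?_)
    simp only [hprod x i]
    ring
  have hz := integral_gaussWeightChi_mul_sum_fderiv_angular_eq_zero hw hwc (a := a)
  have hz' : (∫ x, (Real.exp (a / 4 * ‖x‖ ^ 2) * (1 + ‖x‖ ^ 2)⁻¹) * fderiv ℝ (fun y : EuclideanSpace ℝ (Fin 2) => fderiv ℝ w y (perp y)) x (EuclideanSpace.single 0 1) * fderiv ℝ w x (EuclideanSpace.single 0 1)) +
      ∫ x, (Real.exp (a / 4 * ‖x‖ ^ 2) * (1 + ‖x‖ ^ 2)⁻¹) * fderiv ℝ (fun y : EuclideanSpace ℝ (Fin 2) => fderiv ℝ w y (perp y)) x (EuclideanSpace.single 1 1) * fderiv ℝ w x (EuclideanSpace.single 1 1) = 0 := by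
    rw [← integral_add (i2 0) (i2 1), ← hz]
    refine integral_congr_ae (Eventually.of_forall fun x => ?_)
    ring
  rw [hL, hibp 0, hibp 1, hsplit 0, hsplit 1, integral_add (i1 0) (i1 1)]
  linarith [hz']

/-- **Bound of the `w`-part**: `|∫ pχ ∂_θw (L+λM)w| ≤ (a + 8) ∫ p|∇w|²` for `λ ∈ [0,1]`, `a ≥ 0`.
[folklore] -/
theorem abs_integral_gaussWeightChi_angular_mul_strained_le (ha : 0 ≤ a) {lam : ℝ} (hlam0 : 0 ≤ lam)
    (hlam1 : lam ≤ 1) :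
    |∫ x, (Real.exp (a / 4 * ‖x‖ ^ 2) * (1 + ‖x‖ ^ 2)⁻¹) * fderiv ℝ w x (perp x) * strainedVorticityOperator lam w x| ≤ (a + 8) * ∫ x, Real.exp (a / 4 * ‖x‖ ^ 2) * (fderiv ℝ w x (EuclideanSpace.single 0 1) ^ 2 + fderiv ℝ w x (EuclideanSpace.single 1 1) ^ 2) := by
  have hw1 : ContDiff ℝ 1 w := hw.of_le one_le_two
  have hdi : ∀ i : Fin 2, ContDiff ℝ 1 (fun y => fderiv ℝ w y (EuclideanSpace.single i 1)) := fun i =>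
    (hw.fderiv_right (m := 1) (by norm_num)).clm_apply contDiff_const
  have hds : ∀ i : Fin 2, HasCompactSupport (fun y => fderiv ℝ w y (EuclideanSpace.single i 1)) := fun i => hwc.fderiv_apply (𝕜 := ℝ) _
  have hgc : ∀ i : Fin 2, Continuous (fun y => fderiv ℝ w y (EuclideanSpace.single i 1)) := fun i => (hdi i).continuous
  have hF := contDiff_gaussWeightChi a
  have hFc := hF.continuous
  have hθ := contDiff_one_angular hw
  have hθc := hθ.continuous
  have hpc : Continuous fun x : EuclideanSpace ℝ (Fin 2) => Real.exp (a / 4 * ‖x‖ ^ 2) := (contDiff_gaussWeightExp a (n := 0)).continuous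
  have hpj : ∀ j : Fin 2, Continuous fun x : EuclideanSpace ℝ (Fin 2) => x j := fun j =>
    (EuclideanSpace.proj (j : Fin 2) : EuclideanSpace ℝ (Fin 2) →L[ℝ] ℝ).continuous
  have hAc := continuous_strainedVorticityOperator_of_contDiff_two hw lam
  have hAs := hasCompactSupport_strainedVorticityOperator hw hwc lam
  -- integrability of the pieces
  have iX : ∀ i : Fin 2, Integrable fun x : EuclideanSpace ℝ (Fin 2) => Real.exp (a / 4 * ‖x‖ ^ 2) * fderiv ℝ w x (EuclideanSpace.single i 1) ^ 2 := by
    intro i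
    have : Integrable fun x : EuclideanSpace ℝ (Fin 2) => Real.exp (a / 4 * ‖x‖ ^ 2) * fderiv ℝ w x (EuclideanSpace.single i 1) * fderiv ℝ w x (EuclideanSpace.single i 1) :=
      integrable_mul_of_hasCompactSupport' (hpc.mul (hgc i)) (hgc i) (hds i)
    exact this.congr (Eventually.of_forall fun x => by beta_reduce; ring)
  have iX01 : Integrable fun x : EuclideanSpace ℝ (Fin 2) => Real.exp (a / 4 * ‖x‖ ^ 2) * (fderiv ℝ w x (EuclideanSpace.single 0 1) ^ 2 + fderiv ℝ w x (EuclideanSpace.single 1 1) ^ 2) := by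
    have : Integrable fun x : EuclideanSpace ℝ (Fin 2) => Real.exp (a / 4 * ‖x‖ ^ 2) * fderiv ℝ w x (EuclideanSpace.single 0 1) ^ 2 + Real.exp (a / 4 * ‖x‖ ^ 2) * fderiv ℝ w x (EuclideanSpace.single 1 1) ^ 2 := (iX 0).add (iX 1)
    exact this.congr (Eventually.of_forall fun x => by beta_reduce; ring)
  have iΔ : Integrable fun x => (Real.exp (a / 4 * ‖x‖ ^ 2) * (1 + ‖x‖ ^ 2)⁻¹) * fderiv ℝ w x (perp x) * Δ w x := by
    have hΔ : (Δ w) = fun x => fderiv ℝ (fun y => fderiv ℝ w y (EuclideanSpace.single 0 1)) x (EuclideanSpace.single 0 1) + fderiv ℝ (fun y => fderiv ℝ w y (EuclideanSpace.single 1 1)) x (EuclideanSpace.single 1 1) := funext (laplacian_eq_fin_two_of_contDiff_two'' hw)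
    have hΔc : Continuous (Δ w) := by
      rw [hΔ]; exact (continuous_fderiv_fderiv_of_contDiff_two hw _ _).add
        (continuous_fderiv_fderiv_of_contDiff_two hw _ _)
    have hΔs : HasCompactSupport (Δ w) := by
      rw [hΔ]; exact ((hds 0).fderiv_apply (𝕜 := ℝ) _).add ((hds 1).fderiv_apply (𝕜 := ℝ) _)
    exact integrable_mul_of_hasCompactSupport' (hFc.mul hθc) hΔc hΔs
  have iD : ∀ i : Fin 2, Integrable fun x => (Real.exp (a / 4 * ‖x‖ ^ 2) * (1 + ‖x‖ ^ 2)⁻¹) * fderiv ℝ w x (perp x) * (x i * fderiv ℝ w x (EuclideanSpace.single i 1)) := by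
    intro i
    have : Integrable fun x => (Real.exp (a / 4 * ‖x‖ ^ 2) * (1 + ‖x‖ ^ 2)⁻¹) * fderiv ℝ w x (perp x) * x i * fderiv ℝ w x (EuclideanSpace.single i 1) :=
      integrable_mul_of_hasCompactSupport' ((hFc.mul hθc).mul (hpj i)) (hgc i) (hds i)
    exact this.congr (Eventually.of_forall fun x => by beta_reduce; ring)
  have iW : Integrable fun x => (Real.exp (a / 4 * ‖x‖ ^ 2) * (1 + ‖x‖ ^ 2)⁻¹) * fderiv ℝ w x (perp x) * w x :=
    integrable_mul_of_hasCompactSupport' (hFc.mul hθc) hw.continuous hwc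
  -- split along `L_λ w = Δw + (1+λ)/2 x₀∂₀w + (1−λ)/2 x₁∂₁w + w`
  have hsplit : ∫ x, (Real.exp (a / 4 * ‖x‖ ^ 2) * (1 + ‖x‖ ^ 2)⁻¹) * fderiv ℝ w x (perp x) * strainedVorticityOperator lam w x =
      (∫ x, (Real.exp (a / 4 * ‖x‖ ^ 2) * (1 + ‖x‖ ^ 2)⁻¹) * fderiv ℝ w x (perp x) * Δ w x) + (1 + lam) / 2 * (∫ x, (Real.exp (a / 4 * ‖x‖ ^ 2) * (1 + ‖x‖ ^ 2)⁻¹) * fderiv ℝ w x (perp x) * (x 0 * fderiv ℝ w x (EuclideanSpace.single 0 1))) +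
      (1 - lam) / 2 * (∫ x, (Real.exp (a / 4 * ‖x‖ ^ 2) * (1 + ‖x‖ ^ 2)⁻¹) * fderiv ℝ w x (perp x) * (x 1 * fderiv ℝ w x (EuclideanSpace.single 1 1))) + ∫ x, (Real.exp (a / 4 * ‖x‖ ^ 2) * (1 + ‖x‖ ^ 2)⁻¹) * fderiv ℝ w x (perp x) * w x := by
    have k1 : Integrable fun x => (1 + lam) / 2 * ((Real.exp (a / 4 * ‖x‖ ^ 2) * (1 + ‖x‖ ^ 2)⁻¹) * fderiv ℝ w x (perp x) * (x 0 * fderiv ℝ w x (EuclideanSpace.single 0 1))) := (iD 0).const_mul _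
    have k2 : Integrable fun x => (1 - lam) / 2 * ((Real.exp (a / 4 * ‖x‖ ^ 2) * (1 + ‖x‖ ^ 2)⁻¹) * fderiv ℝ w x (perp x) * (x 1 * fderiv ℝ w x (EuclideanSpace.single 1 1))) := (iD 1).const_mul _
    have hF2 : Integrable fun x => (Real.exp (a / 4 * ‖x‖ ^ 2) * (1 + ‖x‖ ^ 2)⁻¹) * fderiv ℝ w x (perp x) * Δ w x + (1 + lam) / 2 * ((Real.exp (a / 4 * ‖x‖ ^ 2) * (1 + ‖x‖ ^ 2)⁻¹) * fderiv ℝ w x (perp x) * (x 0 * fderiv ℝ w x (EuclideanSpace.single 0 1))) :=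
      iΔ.add k1
    have hF3 : Integrable fun x => (Real.exp (a / 4 * ‖x‖ ^ 2) * (1 + ‖x‖ ^ 2)⁻¹) * fderiv ℝ w x (perp x) * Δ w x + (1 + lam) / 2 * ((Real.exp (a / 4 * ‖x‖ ^ 2) * (1 + ‖x‖ ^ 2)⁻¹) * fderiv ℝ w x (perp x) * (x 0 * fderiv ℝ w x (EuclideanSpace.single 0 1))) +
        (1 - lam) / 2 * ((Real.exp (a / 4 * ‖x‖ ^ 2) * (1 + ‖x‖ ^ 2)⁻¹) * fderiv ℝ w x (perp x) * (x 1 * fderiv ℝ w x (EuclideanSpace.single 1 1))) := hF2.add k2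
    rw [← integral_const_mul, ← integral_const_mul, ← integral_add iΔ k1, ← integral_add hF2 k2,
      ← integral_add hF3 iW]
    refine integral_congr_ae (Eventually.of_forall fun x => ?_)
    simp only [strainedVorticityOperator]
    ring
  -- the zero-order term vanishes
  have hzero : ∫ x, (Real.exp (a / 4 * ‖x‖ ^ 2) * (1 + ‖x‖ ^ 2)⁻¹) * fderiv ℝ w x (perp x) * w x = 0 := by
    have h := integral_mul_mul_fderiv_perp_eq_zero hF hw1 (fderiv_gaussWeightChi_perp a)
      (g := w) ?_ ?_ ?_
    · rw [← h]; exact integral_congr_ae (Eventually.of_forall fun x => by beta_reduce; ring)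
    · have hs1 : HasCompactSupport fun x : EuclideanSpace ℝ (Fin 2) => |w x| := hwc.norm
      exact (continuous_norm.mul (((hFc.mul hw.continuous).abs).mul hw.continuous.abs))
        |>.integrable_of_hasCompactSupport (hs1.mul_left.mul_left)
    · have hs2 : HasCompactSupport fun x : EuclideanSpace ℝ (Fin 2) => |(fun y : EuclideanSpace ℝ (Fin 2) => Real.exp (a / 4 * ‖y‖ ^ 2) * (1 + ‖y‖ ^ 2)⁻¹) x * w x| := (hwc.mul_left).norm
      exact (continuous_norm.mul (((hFc.mul hw.continuous).abs).mul
        (hw1.continuous_fderiv one_ne_zero).norm)).integrable_of_hasCompactSupport (hs2.mul_right.mul_left)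
    · have hs1 : HasCompactSupport fun x : EuclideanSpace ℝ (Fin 2) => |w x| := hwc.norm
      exact (continuous_norm.mul (((hF.mul hw1).continuous_fderiv one_ne_zero).norm.mul
        hw.continuous.abs)).integrable_of_hasCompactSupport (hs1.mul_left.mul_left)
  -- the Laplacian term
  have hχ : ∀ x : EuclideanSpace ℝ (Fin 2), (1 + ‖x‖ ^ 2)⁻¹ * ‖x‖ ^ 2 ≤ 1 := fun x => (chi_bounds x).2.2.1
  have hxi : ∀ (x : EuclideanSpace ℝ (Fin 2)) (i : Fin 2), |x i| ≤ ‖x‖ := fun x i => by simpa using PiLp.norm_apply_le x i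
  have hΔb : |∫ x, (Real.exp (a / 4 * ‖x‖ ^ 2) * (1 + ‖x‖ ^ 2)⁻¹) * fderiv ℝ w x (perp x) * Δ w x| ≤ (a + 4) * ∫ x, Real.exp (a / 4 * ‖x‖ ^ 2) * (fderiv ℝ w x (EuclideanSpace.single 0 1) ^ 2 + fderiv ℝ w x (EuclideanSpace.single 1 1) ^ 2) := by
    rw [integral_gaussWeightChi_angular_mul_laplacian_eq hw hwc, abs_neg]
    have hc : ∀ i : Fin 2, Continuous fun x => fderiv ℝ (fun y : EuclideanSpace ℝ (Fin 2) => Real.exp (a / 4 * ‖y‖ ^ 2) * (1 + ‖y‖ ^ 2)⁻¹) x (EuclideanSpace.single i 1) := fun i =>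
      (hF.continuous_fderiv one_ne_zero).clm_apply continuous_const
    have i1 : ∀ i : Fin 2, Integrable fun x => fderiv ℝ (fun y : EuclideanSpace ℝ (Fin 2) => Real.exp (a / 4 * ‖y‖ ^ 2) * (1 + ‖y‖ ^ 2)⁻¹) x (EuclideanSpace.single i 1) * fderiv ℝ w x (perp x) * fderiv ℝ w x (EuclideanSpace.single i 1) :=
      fun i => integrable_mul_of_hasCompactSupport' ((hc i).mul hθc) (hgc i) (hds i)
    have hi : Integrable fun x => fderiv ℝ (fun y : EuclideanSpace ℝ (Fin 2) => Real.exp (a / 4 * ‖y‖ ^ 2) * (1 + ‖y‖ ^ 2)⁻¹) x (EuclideanSpace.single 0 1) * fderiv ℝ w x (perp x) * fderiv ℝ w x (EuclideanSpace.single 0 1) +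
        fderiv ℝ (fun y : EuclideanSpace ℝ (Fin 2) => Real.exp (a / 4 * ‖y‖ ^ 2) * (1 + ‖y‖ ^ 2)⁻¹) x (EuclideanSpace.single 1 1) * fderiv ℝ w x (perp x) * fderiv ℝ w x (EuclideanSpace.single 1 1) := (i1 0).add (i1 1)
    have hpt : ∀ x : EuclideanSpace ℝ (Fin 2), |fderiv ℝ (fun y : EuclideanSpace ℝ (Fin 2) => Real.exp (a / 4 * ‖y‖ ^ 2) * (1 + ‖y‖ ^ 2)⁻¹) x (EuclideanSpace.single 0 1) * fderiv ℝ w x (perp x) * fderiv ℝ w x (EuclideanSpace.single 0 1) +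
        fderiv ℝ (fun y : EuclideanSpace ℝ (Fin 2) => Real.exp (a / 4 * ‖y‖ ^ 2) * (1 + ‖y‖ ^ 2)⁻¹) x (EuclideanSpace.single 1 1) * fderiv ℝ w x (perp x) * fderiv ℝ w x (EuclideanSpace.single 1 1)| ≤
        (a + 4) * (Real.exp (a / 4 * ‖x‖ ^ 2) * (fderiv ℝ w x (EuclideanSpace.single 0 1) ^ 2 + fderiv ℝ w x (EuclideanSpace.single 1 1) ^ 2)) := by
      intro x
      have hb := fun i => abs_fderiv_gaussWeightChi_single_le ha x i
      have hθb := abs_angular_le (w := w) x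
      have hP0 : 0 < Real.exp (a / 4 * ‖x‖ ^ 2) := Real.exp_pos _
      have hχ0 : 0 < (1 + ‖x‖ ^ 2)⁻¹ := by positivity
      set d0 := fderiv ℝ w x (EuclideanSpace.single 0 1) with hd0
      set d1 := fderiv ℝ w x (EuclideanSpace.single 1 1) with hd1
      set θw := fderiv ℝ w x (perp x)
      set q0 := fderiv ℝ (fun y : EuclideanSpace ℝ (Fin 2) => Real.exp (a / 4 * ‖y‖ ^ 2) * (1 + ‖y‖ ^ 2)⁻¹) x (EuclideanSpace.single 0 1)
      set q1 := fderiv ℝ (fun y : EuclideanSpace ℝ (Fin 2) => Real.exp (a / 4 * ‖y‖ ^ 2) * (1 + ‖y‖ ^ 2)⁻¹) x (EuclideanSpace.single 1 1)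
      have hq0 : |q0| ≤ (a / 2 + 2) * ‖x‖ * (Real.exp (a / 4 * ‖x‖ ^ 2) * (1 + ‖x‖ ^ 2)⁻¹) :=
        (hb 0).trans (by gcongr; exact hxi x 0)
      have hq1 : |q1| ≤ (a / 2 + 2) * ‖x‖ * (Real.exp (a / 4 * ‖x‖ ^ 2) * (1 + ‖x‖ ^ 2)⁻¹) :=
        (hb 1).trans (by gcongr; exact hxi x 1)
      have hS : |d0| + |d1| ≥ 0 := by positivity
      have key : ∀ (q d : ℝ), |q| ≤ (a / 2 + 2) * ‖x‖ * (Real.exp (a / 4 * ‖x‖ ^ 2) * (1 + ‖x‖ ^ 2)⁻¹) →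
          |q * θw * d| ≤ (a / 2 + 2) * Real.exp (a / 4 * ‖x‖ ^ 2) * ((|d0| + |d1|) * |d|) := by
        intro q d hq
        rw [abs_mul, abs_mul]
        calc |q| * |θw| * |d| ≤ ((a / 2 + 2) * ‖x‖ * (Real.exp (a / 4 * ‖x‖ ^ 2) * (1 + ‖x‖ ^ 2)⁻¹)) *
              (‖x‖ * (|d0| + |d1|)) * |d| := by gcongr
          _ = (a / 2 + 2) * Real.exp (a / 4 * ‖x‖ ^ 2) * ((1 + ‖x‖ ^ 2)⁻¹ * ‖x‖ ^ 2) * ((|d0| + |d1|) * |d|) := by ring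
          _ ≤ (a / 2 + 2) * Real.exp (a / 4 * ‖x‖ ^ 2) * 1 * ((|d0| + |d1|) * |d|) := by gcongr; exact hχ x
          _ = _ := by ring
      have k0 := key q0 d0 hq0
      have k1 := key q1 d1 hq1
      have hsq : (|d0| + |d1|) * (|d0| + |d1|) ≤ 2 * (d0 ^ 2 + d1 ^ 2) := by
        nlinarith [sq_nonneg (|d0| - |d1|), sq_abs d0, sq_abs d1]
      calc |q0 * θw * d0 + q1 * θw * d1| ≤ |q0 * θw * d0| + |q1 * θw * d1| := abs_add_le _ _
        _ ≤ (a / 2 + 2) * Real.exp (a / 4 * ‖x‖ ^ 2) * ((|d0| + |d1|) * |d0|) + (a / 2 + 2) * Real.exp (a / 4 * ‖x‖ ^ 2) * ((|d0| + |d1|) * |d1|) :=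
            add_le_add k0 k1
        _ = (a / 2 + 2) * Real.exp (a / 4 * ‖x‖ ^ 2) * ((|d0| + |d1|) * (|d0| + |d1|)) := by ring
        _ ≤ (a / 2 + 2) * Real.exp (a / 4 * ‖x‖ ^ 2) * (2 * (d0 ^ 2 + d1 ^ 2)) := by gcongr
        _ = _ := by ring
    calc |∫ x, fderiv ℝ (fun y : EuclideanSpace ℝ (Fin 2) => Real.exp (a / 4 * ‖y‖ ^ 2) * (1 + ‖y‖ ^ 2)⁻¹) x (EuclideanSpace.single 0 1) * fderiv ℝ w x (perp x) * fderiv ℝ w x (EuclideanSpace.single 0 1) +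
          fderiv ℝ (fun y : EuclideanSpace ℝ (Fin 2) => Real.exp (a / 4 * ‖y‖ ^ 2) * (1 + ‖y‖ ^ 2)⁻¹) x (EuclideanSpace.single 1 1) * fderiv ℝ w x (perp x) * fderiv ℝ w x (EuclideanSpace.single 1 1)|
        ≤ ∫ x, |fderiv ℝ (fun y : EuclideanSpace ℝ (Fin 2) => Real.exp (a / 4 * ‖y‖ ^ 2) * (1 + ‖y‖ ^ 2)⁻¹) x (EuclideanSpace.single 0 1) * fderiv ℝ w x (perp x) * fderiv ℝ w x (EuclideanSpace.single 0 1) +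
          fderiv ℝ (fun y : EuclideanSpace ℝ (Fin 2) => Real.exp (a / 4 * ‖y‖ ^ 2) * (1 + ‖y‖ ^ 2)⁻¹) x (EuclideanSpace.single 1 1) * fderiv ℝ w x (perp x) * fderiv ℝ w x (EuclideanSpace.single 1 1)| := abs_integral_le_integral_abs
      _ ≤ ∫ x, (a + 4) * (Real.exp (a / 4 * ‖x‖ ^ 2) * (fderiv ℝ w x (EuclideanSpace.single 0 1) ^ 2 + fderiv ℝ w x (EuclideanSpace.single 1 1) ^ 2)) := integral_mono hi.abs (iX01.const_mul _) hpt
      _ = (a + 4) * ∫ x, Real.exp (a / 4 * ‖x‖ ^ 2) * (fderiv ℝ w x (EuclideanSpace.single 0 1) ^ 2 + fderiv ℝ w x (EuclideanSpace.single 1 1) ^ 2) := integral_const_mul _ _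
  -- the drift terms
  have hDb : ∀ i : Fin 2, |∫ x, (Real.exp (a / 4 * ‖x‖ ^ 2) * (1 + ‖x‖ ^ 2)⁻¹) * fderiv ℝ w x (perp x) * (x i * fderiv ℝ w x (EuclideanSpace.single i 1))| ≤ 2 * ∫ x, Real.exp (a / 4 * ‖x‖ ^ 2) * (fderiv ℝ w x (EuclideanSpace.single 0 1) ^ 2 + fderiv ℝ w x (EuclideanSpace.single 1 1) ^ 2) := by
    intro i
    have hpt : ∀ x : EuclideanSpace ℝ (Fin 2), |(Real.exp (a / 4 * ‖x‖ ^ 2) * (1 + ‖x‖ ^ 2)⁻¹) * fderiv ℝ w x (perp x) * (x i * fderiv ℝ w x (EuclideanSpace.single i 1))| ≤ 2 * (Real.exp (a / 4 * ‖x‖ ^ 2) * (fderiv ℝ w x (EuclideanSpace.single 0 1) ^ 2 + fderiv ℝ w x (EuclideanSpace.single 1 1) ^ 2)) := by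
      intro x
      have hθb := abs_angular_le (w := w) x
      have hP0 : 0 < Real.exp (a / 4 * ‖x‖ ^ 2) := Real.exp_pos _
      have hχ0 : 0 < (1 + ‖x‖ ^ 2)⁻¹ := by positivity
      have hdi' : |fderiv ℝ w x (EuclideanSpace.single i 1)| ≤ |fderiv ℝ w x (EuclideanSpace.single 0 1)| + |fderiv ℝ w x (EuclideanSpace.single 1 1)| := by
        fin_cases i <;> simp [abs_nonneg]
      simp only [abs_mul, abs_of_pos hP0, abs_of_pos hχ0]
      calc Real.exp (a / 4 * ‖x‖ ^ 2) * (1 + ‖x‖ ^ 2)⁻¹ * |fderiv ℝ w x (perp x)| * (|x i| * |fderiv ℝ w x (EuclideanSpace.single i 1)|)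
          ≤ Real.exp (a / 4 * ‖x‖ ^ 2) * (1 + ‖x‖ ^ 2)⁻¹ * (‖x‖ * (|fderiv ℝ w x (EuclideanSpace.single 0 1)| + |fderiv ℝ w x (EuclideanSpace.single 1 1)|)) * (‖x‖ * (|fderiv ℝ w x (EuclideanSpace.single 0 1)| + |fderiv ℝ w x (EuclideanSpace.single 1 1)|)) := by
            gcongr
            · exact hxi x i
        _ = Real.exp (a / 4 * ‖x‖ ^ 2) * ((1 + ‖x‖ ^ 2)⁻¹ * ‖x‖ ^ 2) * ((|fderiv ℝ w x (EuclideanSpace.single 0 1)| + |fderiv ℝ w x (EuclideanSpace.single 1 1)|) * (|fderiv ℝ w x (EuclideanSpace.single 0 1)| + |fderiv ℝ w x (EuclideanSpace.single 1 1)|)) := by ring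
        _ ≤ Real.exp (a / 4 * ‖x‖ ^ 2) * 1 * (2 * (fderiv ℝ w x (EuclideanSpace.single 0 1) ^ 2 + fderiv ℝ w x (EuclideanSpace.single 1 1) ^ 2)) := by
            have hsq : (|fderiv ℝ w x (EuclideanSpace.single 0 1)| + |fderiv ℝ w x (EuclideanSpace.single 1 1)|) * (|fderiv ℝ w x (EuclideanSpace.single 0 1)| + |fderiv ℝ w x (EuclideanSpace.single 1 1)|) ≤ 2 * (fderiv ℝ w x (EuclideanSpace.single 0 1) ^ 2 + fderiv ℝ w x (EuclideanSpace.single 1 1) ^ 2) := by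
              nlinarith [sq_nonneg (|fderiv ℝ w x (EuclideanSpace.single 0 1)| - |fderiv ℝ w x (EuclideanSpace.single 1 1)|), sq_abs (fderiv ℝ w x (EuclideanSpace.single 0 1)), sq_abs (fderiv ℝ w x (EuclideanSpace.single 1 1))]
            exact mul_le_mul (mul_le_mul_of_nonneg_left (hχ x) hP0.le) hsq (by positivity) (by positivity)
        _ = _ := by ring
    calc |∫ x, (Real.exp (a / 4 * ‖x‖ ^ 2) * (1 + ‖x‖ ^ 2)⁻¹) * fderiv ℝ w x (perp x) * (x i * fderiv ℝ w x (EuclideanSpace.single i 1))| ≤ ∫ x, |(Real.exp (a / 4 * ‖x‖ ^ 2) * (1 + ‖x‖ ^ 2)⁻¹) * fderiv ℝ w x (perp x) * (x i * fderiv ℝ w x (EuclideanSpace.single i 1))| :=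
          abs_integral_le_integral_abs
      _ ≤ ∫ x, 2 * (Real.exp (a / 4 * ‖x‖ ^ 2) * (fderiv ℝ w x (EuclideanSpace.single 0 1) ^ 2 + fderiv ℝ w x (EuclideanSpace.single 1 1) ^ 2)) := integral_mono (iD i).abs (iX01.const_mul _) hpt
      _ = 2 * ∫ x, Real.exp (a / 4 * ‖x‖ ^ 2) * (fderiv ℝ w x (EuclideanSpace.single 0 1) ^ 2 + fderiv ℝ w x (EuclideanSpace.single 1 1) ^ 2) := integral_const_mul _ _
  have hX0 : 0 ≤ ∫ x, Real.exp (a / 4 * ‖x‖ ^ 2) * (fderiv ℝ w x (EuclideanSpace.single 0 1) ^ 2 + fderiv ℝ w x (EuclideanSpace.single 1 1) ^ 2) := integral_nonneg fun x => by positivity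
  rw [hsplit, hzero, add_zero]
  have h0 := hDb 0
  have h1 := hDb 1
  have c0 : |(1 + lam) / 2 * ∫ x, (Real.exp (a / 4 * ‖x‖ ^ 2) * (1 + ‖x‖ ^ 2)⁻¹) * fderiv ℝ w x (perp x) * (x 0 * fderiv ℝ w x (EuclideanSpace.single 0 1))| ≤ 2 * ∫ x, Real.exp (a / 4 * ‖x‖ ^ 2) * (fderiv ℝ w x (EuclideanSpace.single 0 1) ^ 2 + fderiv ℝ w x (EuclideanSpace.single 1 1) ^ 2) := by
    rw [abs_mul, abs_of_nonneg (by linarith only [hlam0, hlam1])]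
    calc _ ≤ 1 * (2 * ∫ x, Real.exp (a / 4 * ‖x‖ ^ 2) * (fderiv ℝ w x (EuclideanSpace.single 0 1) ^ 2 + fderiv ℝ w x (EuclideanSpace.single 1 1) ^ 2)) := mul_le_mul (by linarith only [hlam0, hlam1]) h0 (abs_nonneg _) zero_le_one
      _ = _ := one_mul _
  have c1 : |(1 - lam) / 2 * ∫ x, (Real.exp (a / 4 * ‖x‖ ^ 2) * (1 + ‖x‖ ^ 2)⁻¹) * fderiv ℝ w x (perp x) * (x 1 * fderiv ℝ w x (EuclideanSpace.single 1 1))| ≤ 2 * ∫ x, Real.exp (a / 4 * ‖x‖ ^ 2) * (fderiv ℝ w x (EuclideanSpace.single 0 1) ^ 2 + fderiv ℝ w x (EuclideanSpace.single 1 1) ^ 2) := by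
    rw [abs_mul, abs_of_nonneg (by linarith only [hlam0, hlam1])]
    calc _ ≤ 1 * (2 * ∫ x, Real.exp (a / 4 * ‖x‖ ^ 2) * (fderiv ℝ w x (EuclideanSpace.single 0 1) ^ 2 + fderiv ℝ w x (EuclideanSpace.single 1 1) ^ 2)) := mul_le_mul (by linarith only [hlam0, hlam1]) h1 (abs_nonneg _) zero_le_one
      _ = _ := one_mul _
  calc _ ≤ |(∫ x, (Real.exp (a / 4 * ‖x‖ ^ 2) * (1 + ‖x‖ ^ 2)⁻¹) * fderiv ℝ w x (perp x) * Δ w x) + (1 + lam) / 2 * ∫ x, (Real.exp (a / 4 * ‖x‖ ^ 2) * (1 + ‖x‖ ^ 2)⁻¹) * fderiv ℝ w x (perp x) * (x 0 * fderiv ℝ w x (EuclideanSpace.single 0 1))| +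
        |(1 - lam) / 2 * ∫ x, (Real.exp (a / 4 * ‖x‖ ^ 2) * (1 + ‖x‖ ^ 2)⁻¹) * fderiv ℝ w x (perp x) * (x 1 * fderiv ℝ w x (EuclideanSpace.single 1 1))| := abs_add_le _ _
    _ ≤ |∫ x, (Real.exp (a / 4 * ‖x‖ ^ 2) * (1 + ‖x‖ ^ 2)⁻¹) * fderiv ℝ w x (perp x) * Δ w x| + |(1 + lam) / 2 * ∫ x, (Real.exp (a / 4 * ‖x‖ ^ 2) * (1 + ‖x‖ ^ 2)⁻¹) * fderiv ℝ w x (perp x) * (x 0 * fderiv ℝ w x (EuclideanSpace.single 0 1))| +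
        |(1 - lam) / 2 * ∫ x, (Real.exp (a / 4 * ‖x‖ ^ 2) * (1 + ‖x‖ ^ 2)⁻¹) * fderiv ℝ w x (perp x) * (x 1 * fderiv ℝ w x (EuclideanSpace.single 1 1))| := by gcongr; exact abs_add_le _ _
    _ ≤ (a + 4) * (∫ x, Real.exp (a / 4 * ‖x‖ ^ 2) * (fderiv ℝ w x (EuclideanSpace.single 0 1) ^ 2 + fderiv ℝ w x (EuclideanSpace.single 1 1) ^ 2)) + 2 * (∫ x, Real.exp (a / 4 * ‖x‖ ^ 2) * (fderiv ℝ w x (EuclideanSpace.single 0 1) ^ 2 + fderiv ℝ w x (EuclideanSpace.single 1 1) ^ 2)) + 2 * (∫ x, Real.exp (a / 4 * ‖x‖ ^ 2) * (fderiv ℝ w x (EuclideanSpace.single 0 1) ^ 2 + fderiv ℝ w x (EuclideanSpace.single 1 1) ^ 2)) := by linarith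
    _ = (a + 8) * ∫ x, Real.exp (a / 4 * ‖x‖ ^ 2) * (fderiv ℝ w x (EuclideanSpace.single 0 1) ^ 2 + fderiv ℝ w x (EuclideanSpace.single 1 1) ^ 2) := by ring

end WPart

/-! ### The correction part of the multiplier: `V = Φ⟪v, x⟫ = −Φ ∂_θψ` -/

/-- `√A √X ≤ (A + X)/2`. [folklore] -/
private theorem sqrt_mul_sqrt_le_half (A X : ℝ) (hA : 0 ≤ A) (hX : 0 ≤ X) :
    Real.sqrt A * Real.sqrt X ≤ (A + X) / 2 := by
  nlinarith [sq_nonneg (Real.sqrt A - Real.sqrt X), Real.sq_sqrt hA, Real.sq_sqrt hX,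
    Real.sqrt_nonneg A, Real.sqrt_nonneg X]

/-- `|p + q + r + t| ≤ |p| + |q| + |r| + |t|`. [folklore] -/
private theorem abs_add_four_le_aux (p q r t : ℝ) : |p + q + r + t| ≤ |p| + |q| + |r| + |t| := by
  have h1 := abs_add_le (p + q + r) t
  have h2 := abs_add_le (p + q) r
  have h3 := abs_add_le p q
  linarith

section VPart

variable {w : EuclideanSpace ℝ (Fin 2) → ℝ} (hw : ContDiff ℝ 2 w) (hwc : HasCompactSupport w) {a : ℝ}
include hw hwc

/-- `V = Φ(|x|)⟪v(x), x⟫` is `C¹`. [folklore] -/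
theorem contDiff_one_correctionV : ContDiff ℝ 1 (fun y : EuclideanSpace ℝ (Fin 2) => kerWeight ‖y‖ * ⟪biotSavart2D w y, y⟫) := by
  have hw1 : ContDiff ℝ 1 w := hw.of_le one_le_two
  exact contDiff_kerWeight_norm.mul ((contDiff_biotSavart2D hw1 hwc).inner ℝ contDiff_id)

/-- `∂ᵢV = (∂ᵢΦ)⟪v,x⟫ + Φ(⟪v,eᵢ⟫ + ⟪∂ᵢv, x⟫)` with `∂ᵢv = K_{2D} ∗ ∂ᵢw`. [folklore] -/
theorem fderiv_correctionV_single (x : EuclideanSpace ℝ (Fin 2)) (i : Fin 2) :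
    fderiv ℝ (fun y : EuclideanSpace ℝ (Fin 2) => kerWeight ‖y‖ * ⟪biotSavart2D w y, y⟫) x (EuclideanSpace.single i 1) = (fderiv ℝ (fun y : EuclideanSpace ℝ (Fin 2) => kerWeight ‖y‖) x (EuclideanSpace.single i 1) * ⟪biotSavart2D w x, x⟫ + kerWeight ‖x‖ * (⟪biotSavart2D w x, EuclideanSpace.single i 1⟫ + ⟪biotSavart2D (fun y => fderiv ℝ w y (EuclideanSpace.single i 1)) x, x⟫)) := by
  have hw1 : ContDiff ℝ 1 w := hw.of_le one_le_two
  have hΦ : HasFDerivAt (fun y : EuclideanSpace ℝ (Fin 2) => kerWeight ‖y‖) (fderiv ℝ (fun y : EuclideanSpace ℝ (Fin 2) => kerWeight ‖y‖) x) x := (differentiableAt_kerWeight_norm x).hasFDerivAt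
  have hv : HasFDerivAt (biotSavart2D w) (fderiv ℝ (biotSavart2D w) x) x :=
    (((contDiff_biotSavart2D hw1 hwc).differentiable one_ne_zero) x).hasFDerivAt
  have hid : HasFDerivAt (fun y : EuclideanSpace ℝ (Fin 2) => y)
      (ContinuousLinearMap.id ℝ (EuclideanSpace ℝ (Fin 2))) x := hasFDerivAt_id x
  have hinner := hv.inner ℝ hid
  rw [(hΦ.fun_mul hinner).fderiv]
  simp only [_root_.add_apply, _root_.smul_apply, smul_eq_mul, ContinuousLinearMap.comp_apply,
    ContinuousLinearMap.prod_apply, fderivInnerCLM_apply, ContinuousLinearMap.id_apply,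
    fderiv_biotSavart2D_apply hw1 hwc]
  ring

/-- **Integration by parts of `∫ pχ V Δw`**: `∫ pχ V Δw = −Σᵢ ∫ (∂ᵢ(pχ) V + pχ ∂ᵢV) ∂ᵢw`.
[folklore] -/
theorem integral_gaussWeightChi_correctionV_mul_laplacian_eq :
    ∫ x, (Real.exp (a / 4 * ‖x‖ ^ 2) * (1 + ‖x‖ ^ 2)⁻¹) * (kerWeight ‖x‖ * ⟪biotSavart2D w x, x⟫) * Δ w x =
      -∫ x, (fderiv ℝ (fun y : EuclideanSpace ℝ (Fin 2) => Real.exp (a / 4 * ‖y‖ ^ 2) * (1 + ‖y‖ ^ 2)⁻¹) x (EuclideanSpace.single 0 1) * (kerWeight ‖x‖ * ⟪biotSavart2D w x, x⟫) + (Real.exp (a / 4 * ‖x‖ ^ 2) * (1 + ‖x‖ ^ 2)⁻¹) * (fderiv ℝ (fun y : EuclideanSpace ℝ (Fin 2) => kerWeight ‖y‖) x (EuclideanSpace.single 0 1) * ⟪biotSavart2D w x, x⟫ + kerWeight ‖x‖ * (⟪biotSavart2D w x, EuclideanSpace.single 0 1⟫ + ⟪biotSavart2D (fun y => fderiv ℝ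 w y (EuclideanSpace.single 0 1)) x, x⟫))) * fderiv ℝ w x (EuclideanSpace.single 0 1) +
        (fderiv ℝ (fun y : EuclideanSpace ℝ (Fin 2) => Real.exp (a / 4 * ‖y‖ ^ 2) * (1 + ‖y‖ ^ 2)⁻¹) x (EuclideanSpace.single 1 1) * (kerWeight ‖x‖ * ⟪biotSavart2D w x, x⟫) + (Real.exp (a / 4 * ‖x‖ ^ 2) * (1 + ‖x‖ ^ 2)⁻¹) * (fderiv ℝ (fun y : EuclideanSpace ℝ (Fin 2) => kerWeight ‖y‖) x (EuclideanSpace.single 1 1) * ⟪biotSavart2D w x, x⟫ + kerWeight ‖x‖ * (⟪biotSavart2D w x, EuclideanSpace.single 1 1⟫ + ⟪biotSavart2D (fun y => fderiv ℝ w y (EuclideanSpace.single 1 1)) x, x⟫))) * fderiv ℝ w x (EuclideanSpace.single 1 1) := by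
  have hw1 : ContDiff ℝ 1 w := hw.of_le one_le_two
  have hdi : ∀ i : Fin 2, ContDiff ℝ 1 (fun y => fderiv ℝ w y (EuclideanSpace.single i 1)) := fun i =>
    (hw.fderiv_right (m := 1) (by norm_num)).clm_apply contDiff_const
  have hds : ∀ i : Fin 2, HasCompactSupport (fun y => fderiv ℝ w y (EuclideanSpace.single i 1)) := fun i => hwc.fderiv_apply (𝕜 := ℝ) _
  have hdds : ∀ i : Fin 2, HasCompactSupport fun x => fderiv ℝ (fun y => fderiv ℝ w y (EuclideanSpace.single i 1)) x (EuclideanSpace.single i 1) := fun i =>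
    (hds i).fderiv_apply (𝕜 := ℝ) _
  have hF := contDiff_gaussWeightChi a
  have hV := contDiff_one_correctionV hw hwc
  have hf : ContDiff ℝ 1 fun y => (fun y : EuclideanSpace ℝ (Fin 2) => Real.exp (a / 4 * ‖y‖ ^ 2) * (1 + ‖y‖ ^ 2)⁻¹) y * (fun y : EuclideanSpace ℝ (Fin 2) => kerWeight ‖y‖ * ⟪biotSavart2D w y, y⟫) y := hF.mul hV
  have hfc := hf.continuous
  have hf'c : ∀ v : EuclideanSpace ℝ (Fin 2), Continuous fun x => fderiv ℝ (fun y => (fun y : EuclideanSpace ℝ (Fin 2) => Real.exp (a / 4 * ‖y‖ ^ 2) * (1 + ‖y‖ ^ 2)⁻¹) y * (fun y : EuclideanSpace ℝ (Fin 2) => kerWeight ‖y‖ * ⟪biotSavart2D w y, y⟫) y) x v := fun v =>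
    (hf.continuous_fderiv one_ne_zero).clm_apply continuous_const
  have hgc : ∀ i : Fin 2, Continuous (fun y => fderiv ℝ w y (EuclideanSpace.single i 1)) := fun i => (hdi i).continuous
  have hg'c : ∀ i : Fin 2, Continuous fun x => fderiv ℝ (fun y => fderiv ℝ w y (EuclideanSpace.single i 1)) x (EuclideanSpace.single i 1) := fun i =>
    ((hdi i).continuous_fderiv one_ne_zero).clm_apply continuous_const
  have hibp : ∀ i : Fin 2, ∫ x, (fun y : EuclideanSpace ℝ (Fin 2) => Real.exp (a / 4 * ‖y‖ ^ 2) * (1 + ‖y‖ ^ 2)⁻¹) x * (fun y : EuclideanSpace ℝ (Fin 2) => kerWeight ‖y‖ * ⟪biotSavart2D w y, y⟫) x * fderiv ℝ (fun y => fderiv ℝ w y (EuclideanSpace.single i 1)) x (EuclideanSpace.single i 1) =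
      -∫ x, fderiv ℝ (fun y => (fun y : EuclideanSpace ℝ (Fin 2) => Real.exp (a / 4 * ‖y‖ ^ 2) * (1 + ‖y‖ ^ 2)⁻¹) y * (fun y : EuclideanSpace ℝ (Fin 2) => kerWeight ‖y‖ * ⟪biotSavart2D w y, y⟫) y) x (EuclideanSpace.single i 1) * fderiv ℝ w x (EuclideanSpace.single i 1) := by
    intro i
    exact integral_mul_fderiv_eq_neg_fderiv_mul_of_integrable (μ := volume)
      (v := EuclideanSpace.single i 1)
      (integrable_mul_of_hasCompactSupport' (hf'c _) (hgc i) (hds i))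
      (integrable_mul_of_hasCompactSupport' hfc (hg'c i) (hdds i))
      (integrable_mul_of_hasCompactSupport' hfc (hgc i) (hds i))
      (fun x _ => (hf.differentiable one_ne_zero) x) (fun x _ => ((hdi i).differentiable one_ne_zero) x)
  have hprod : ∀ (x : EuclideanSpace ℝ (Fin 2)) (i : Fin 2), fderiv ℝ (fun y => (fun y : EuclideanSpace ℝ (Fin 2) => Real.exp (a / 4 * ‖y‖ ^ 2) * (1 + ‖y‖ ^ 2)⁻¹) y * (fun y : EuclideanSpace ℝ (Fin 2) => kerWeight ‖y‖ * ⟪biotSavart2D w y, y⟫) y) x (EuclideanSpace.single i 1) =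
      fderiv ℝ (fun y : EuclideanSpace ℝ (Fin 2) => Real.exp (a / 4 * ‖y‖ ^ 2) * (1 + ‖y‖ ^ 2)⁻¹) x (EuclideanSpace.single i 1) * (kerWeight ‖x‖ * ⟪biotSavart2D w x, x⟫) + (Real.exp (a / 4 * ‖x‖ ^ 2) * (1 + ‖x‖ ^ 2)⁻¹) * (fderiv ℝ (fun y : EuclideanSpace ℝ (Fin 2) => kerWeight ‖y‖) x (EuclideanSpace.single i 1) * ⟪biotSavart2D w x, x⟫ + kerWeight ‖x‖ * (⟪biotSavart2D w x, EuclideanSpace.single i 1⟫ + ⟪biotSavart2D (fun y => fderiv ℝ w y (EuclideanSpace.single i 1)) x, x⟫)) := by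
    intro x i
    have h1 : HasFDerivAt (fun y : EuclideanSpace ℝ (Fin 2) => Real.exp (a / 4 * ‖y‖ ^ 2) * (1 + ‖y‖ ^ 2)⁻¹) (fderiv ℝ (fun y : EuclideanSpace ℝ (Fin 2) => Real.exp (a / 4 * ‖y‖ ^ 2) * (1 + ‖y‖ ^ 2)⁻¹) x) x := ((hF.differentiable one_ne_zero) x).hasFDerivAt
    have h2 : HasFDerivAt (fun y : EuclideanSpace ℝ (Fin 2) => kerWeight ‖y‖ * ⟪biotSavart2D w y, y⟫) (fderiv ℝ (fun y : EuclideanSpace ℝ (Fin 2) => kerWeight ‖y‖ * ⟪biotSavart2D w y, y⟫) x) x := ((hV.differentiable one_ne_zero) x).hasFDerivAt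
    rw [(h1.fun_mul h2).fderiv]
    simp only [_root_.add_apply, _root_.smul_apply, smul_eq_mul, fderiv_correctionV_single hw hwc x i]
    ring
  have hΔ : ∀ x, Δ w x = fderiv ℝ (fun y => fderiv ℝ w y (EuclideanSpace.single 0 1)) x (EuclideanSpace.single 0 1) + fderiv ℝ (fun y => fderiv ℝ w y (EuclideanSpace.single 1 1)) x (EuclideanSpace.single 1 1) := laplacian_eq_fin_two_of_contDiff_two'' hw
  have hL : ∫ x, (Real.exp (a / 4 * ‖x‖ ^ 2) * (1 + ‖x‖ ^ 2)⁻¹) * (kerWeight ‖x‖ * ⟪biotSavart2D w x, x⟫) * Δ w x = (∫ x, (fun y : EuclideanSpace ℝ (Fin 2) => Real.exp (a / 4 * ‖y‖ ^ 2) * (1 + ‖y‖ ^ 2)⁻¹) x * (fun y : EuclideanSpace ℝ (Fin 2) => kerWeight ‖y‖ * ⟪biotSavart2D w y, y⟫) x * fderiv ℝ (fun y => fderiv ℝ w y (EuclideanSpace.single 0 1)) x (EuclideanSpace.single 0 1)) +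
      ∫ x, (fun y : EuclideanSpace ℝ (Fin 2) => Real.exp (a / 4 * ‖y‖ ^ 2) * (1 + ‖y‖ ^ 2)⁻¹) x * (fun y : EuclideanSpace ℝ (Fin 2) => kerWeight ‖y‖ * ⟪biotSavart2D w y, y⟫) x * fderiv ℝ (fun y => fderiv ℝ w y (EuclideanSpace.single 1 1)) x (EuclideanSpace.single 1 1) := by
    rw [← integral_add (integrable_mul_of_hasCompactSupport' hfc (hg'c 0) (hdds 0))
      (integrable_mul_of_hasCompactSupport' hfc (hg'c 1) (hdds 1))]
    refine integral_congr_ae (Eventually.of_forall fun x => ?_)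
    simp only [hΔ x]
    ring
  have i1 : ∀ i : Fin 2, Integrable fun x =>
      fderiv ℝ (fun y => (fun y : EuclideanSpace ℝ (Fin 2) => Real.exp (a / 4 * ‖y‖ ^ 2) * (1 + ‖y‖ ^ 2)⁻¹) y * (fun y : EuclideanSpace ℝ (Fin 2) => kerWeight ‖y‖ * ⟪biotSavart2D w y, y⟫) y) x (EuclideanSpace.single i 1) * fderiv ℝ w x (EuclideanSpace.single i 1) :=
    fun i => integrable_mul_of_hasCompactSupport' (hf'c _) (hgc i) (hds i)
  rw [hL, hibp 0, hibp 1, ← neg_add, ← integral_add (i1 0) (i1 1)]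
  congr 1
  refine integral_congr_ae (Eventually.of_forall fun x => ?_)
  simp only [hprod x]

omit hw hwc in
/-- **Pointwise bound of `Bᵢ = ∂ᵢ(pχ)V + pχ∂ᵢV`**:
`|Bᵢ| ≤ p ((a/2+3)Φ|v| + ‖DΦ‖|v| + Φ|∂ᵢv|)` (`χ|x|² ≤ 1`, `χ|x| ≤ 1`, `χ ≤ 1`). [folklore] -/
theorem abs_correctionB_le (ha : 0 ≤ a) (x : EuclideanSpace ℝ (Fin 2)) (i : Fin 2) :
    |(fderiv ℝ (fun y : EuclideanSpace ℝ (Fin 2) => Real.exp (a / 4 * ‖y‖ ^ 2) * (1 + ‖y‖ ^ 2)⁻¹) x (EuclideanSpace.single i 1) * (kerWeight ‖x‖ * ⟪biotSavart2D w x, x⟫) + (Real.exp (a / 4 * ‖x‖ ^ 2) * (1 + ‖x‖ ^ 2)⁻¹) * (fderiv ℝ (fun y : EuclideanSpace ℝ (Fin 2) => kerWeight ‖y‖) x (EuclideanSpace.single i 1) * ⟪biotSavart2D w x, x⟫ + kerWeight ‖x‖ * (⟪biotSavart2D w x, EuclideanSpace.single i 1⟫ + ⟪biotSavart2D (fun y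 => fderiv ℝ w y (EuclideanSpace.single i 1)) x, x⟫)))| ≤ Real.exp (a / 4 * ‖x‖ ^ 2) * ((a / 2 + 3) * kerWeight ‖x‖ * ‖biotSavart2D w x‖ + ‖fderiv ℝ (fun y : EuclideanSpace ℝ (Fin 2) => kerWeight ‖y‖) x‖ * ‖biotSavart2D w x‖ + kerWeight ‖x‖ * ‖biotSavart2D (fun y => fderiv ℝ w y (EuclideanSpace.single i 1)) x‖) := by
  obtain ⟨hχ0, hχ1, hχ2, hχ3⟩ := chi_bounds x
  have hP0 : 0 < Real.exp (a / 4 * ‖x‖ ^ 2) := Real.exp_pos _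
  have hΦ0 : 0 ≤ kerWeight ‖x‖ := (kerWeight_pos _).le
  have hxi : |x i| ≤ ‖x‖ := by simpa using PiLp.norm_apply_le x i
  have hq := abs_fderiv_gaussWeightChi_single_le ha x i
  have hvx : |⟪biotSavart2D w x, x⟫| ≤ ‖biotSavart2D w x‖ * ‖x‖ := abs_real_inner_le_norm _ _
  have hve : |⟪biotSavart2D w x, EuclideanSpace.single i (1:ℝ)⟫| ≤ ‖biotSavart2D w x‖ := by
    calc _ ≤ ‖biotSavart2D w x‖ * ‖EuclideanSpace.single i (1:ℝ)‖ := abs_real_inner_le_norm _ _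
      _ = ‖biotSavart2D w x‖ := by simp
  have hdvx : |⟪biotSavart2D (fun y => fderiv ℝ w y (EuclideanSpace.single i 1)) x, x⟫| ≤ ‖biotSavart2D (fun y => fderiv ℝ w y (EuclideanSpace.single i 1)) x‖ * ‖x‖ := abs_real_inner_le_norm _ _
  have hΦ' : |fderiv ℝ (fun y : EuclideanSpace ℝ (Fin 2) => kerWeight ‖y‖) x (EuclideanSpace.single i 1)| ≤ ‖fderiv ℝ (fun y : EuclideanSpace ℝ (Fin 2) => kerWeight ‖y‖) x‖ := by
    have h := (fderiv ℝ (fun y : EuclideanSpace ℝ (Fin 2) => kerWeight ‖y‖) x).le_opNorm (EuclideanSpace.single i 1)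
    have hn : ‖EuclideanSpace.single i (1 : ℝ)‖ = 1 := by simp
    rw [hn, mul_one, Real.norm_eq_abs] at h
    exact h
  -- first piece
  have h1 : |fderiv ℝ (fun y : EuclideanSpace ℝ (Fin 2) => Real.exp (a / 4 * ‖y‖ ^ 2) * (1 + ‖y‖ ^ 2)⁻¹) x (EuclideanSpace.single i 1) * (kerWeight ‖x‖ * ⟪biotSavart2D w x, x⟫)| ≤
      Real.exp (a / 4 * ‖x‖ ^ 2) * ((a / 2 + 2) * kerWeight ‖x‖ * ‖biotSavart2D w x‖) := by
    rw [abs_mul, abs_mul, abs_of_nonneg hΦ0]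
    calc |fderiv ℝ (fun y : EuclideanSpace ℝ (Fin 2) => Real.exp (a / 4 * ‖y‖ ^ 2) * (1 + ‖y‖ ^ 2)⁻¹) x (EuclideanSpace.single i 1)| * (kerWeight ‖x‖ * |⟪biotSavart2D w x, x⟫|)
        ≤ ((a / 2 + 2) * |x i| * (Real.exp (a / 4 * ‖x‖ ^ 2) * (1 + ‖x‖ ^ 2)⁻¹)) * (kerWeight ‖x‖ * (‖biotSavart2D w x‖ * ‖x‖)) := by gcongr
      _ ≤ ((a / 2 + 2) * ‖x‖ * (Real.exp (a / 4 * ‖x‖ ^ 2) * (1 + ‖x‖ ^ 2)⁻¹)) * (kerWeight ‖x‖ * (‖biotSavart2D w x‖ * ‖x‖)) := by gcongr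
      _ = Real.exp (a / 4 * ‖x‖ ^ 2) * ((a / 2 + 2) * kerWeight ‖x‖ * ‖biotSavart2D w x‖) * ((1 + ‖x‖ ^ 2)⁻¹ * ‖x‖ ^ 2) := by ring
      _ ≤ Real.exp (a / 4 * ‖x‖ ^ 2) * ((a / 2 + 2) * kerWeight ‖x‖ * ‖biotSavart2D w x‖) * 1 := by gcongr
      _ = _ := mul_one _
  -- second piece
  have h2 : |(Real.exp (a / 4 * ‖x‖ ^ 2) * (1 + ‖x‖ ^ 2)⁻¹) * (fderiv ℝ (fun y : EuclideanSpace ℝ (Fin 2) => kerWeight ‖y‖) x (EuclideanSpace.single i 1) * ⟪biotSavart2D w x, x⟫ + kerWeight ‖x‖ * (⟪biotSavart2D w x, EuclideanSpace.single i 1⟫ + ⟪biotSavart2D (fun y => fderiv ℝ w y (EuclideanSpace.single i 1)) x, x⟫))| ≤ Real.exp (a / 4 * ‖x‖ ^ 2) * (‖fderiv ℝ (fun y : EuclideanSpace ℝ (Fin 2) => kerWeight ‖y‖) x‖ * ‖biotSavart2D w x‖ + kerWeight ‖x‖ * ‖biotSavart2D w x‖ + kerWeight ‖x‖ * ‖biotSavart2D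 (fun y => fderiv ℝ w y (EuclideanSpace.single i 1)) x‖) := by
    rw [abs_mul, abs_of_pos (by positivity : (0:ℝ) < (Real.exp (a / 4 * ‖x‖ ^ 2) * (1 + ‖x‖ ^ 2)⁻¹))]
    have hin : |(fderiv ℝ (fun y : EuclideanSpace ℝ (Fin 2) => kerWeight ‖y‖) x (EuclideanSpace.single i 1) * ⟪biotSavart2D w x, x⟫ + kerWeight ‖x‖ * (⟪biotSavart2D w x, EuclideanSpace.single i 1⟫ + ⟪biotSavart2D (fun y => fderiv ℝ w y (EuclideanSpace.single i 1)) x, x⟫))| ≤ ‖fderiv ℝ (fun y : EuclideanSpace ℝ (Fin 2) => kerWeight ‖y‖) x‖ * (‖biotSavart2D w x‖ * ‖x‖) + kerWeight ‖x‖ * (‖biotSavart2D w x‖ + ‖biotSavart2D (fun y => fderiv ℝ w y (EuclideanSpace.single i 1)) x‖ * ‖x‖) := by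
      refine (abs_add_le _ _).trans (add_le_add ?_ ?_)
      · rw [abs_mul]; exact mul_le_mul hΦ' hvx (abs_nonneg _) (norm_nonneg _)
      · rw [abs_mul, abs_of_nonneg hΦ0]
        exact mul_le_mul_of_nonneg_left ((abs_add_le _ _).trans (add_le_add hve hdvx)) hΦ0
    calc (Real.exp (a / 4 * ‖x‖ ^ 2) * (1 + ‖x‖ ^ 2)⁻¹) * |(fderiv ℝ (fun y : EuclideanSpace ℝ (Fin 2) => kerWeight ‖y‖) x (EuclideanSpace.single i 1) * ⟪biotSavart2D w x, x⟫ + kerWeight ‖x‖ * (⟪biotSavart2D w x, EuclideanSpace.single i 1⟫ + ⟪biotSavart2D (fun y => fderiv ℝ w y (EuclideanSpace.single i 1)) x, x⟫))|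
        ≤ (Real.exp (a / 4 * ‖x‖ ^ 2) * (1 + ‖x‖ ^ 2)⁻¹) * (‖fderiv ℝ (fun y : EuclideanSpace ℝ (Fin 2) => kerWeight ‖y‖) x‖ * (‖biotSavart2D w x‖ * ‖x‖) + kerWeight ‖x‖ * (‖biotSavart2D w x‖ + ‖biotSavart2D (fun y => fderiv ℝ w y (EuclideanSpace.single i 1)) x‖ * ‖x‖)) :=
          mul_le_mul_of_nonneg_left hin (by positivity)
      _ = Real.exp (a / 4 * ‖x‖ ^ 2) * (‖fderiv ℝ (fun y : EuclideanSpace ℝ (Fin 2) => kerWeight ‖y‖) x‖ * ‖biotSavart2D w x‖ * ((1 + ‖x‖ ^ 2)⁻¹ * ‖x‖) + kerWeight ‖x‖ * ‖biotSavart2D w x‖ * (1 + ‖x‖ ^ 2)⁻¹ +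
          kerWeight ‖x‖ * ‖biotSavart2D (fun y => fderiv ℝ w y (EuclideanSpace.single i 1)) x‖ * ((1 + ‖x‖ ^ 2)⁻¹ * ‖x‖)) := by ring
      _ ≤ Real.exp (a / 4 * ‖x‖ ^ 2) * (‖fderiv ℝ (fun y : EuclideanSpace ℝ (Fin 2) => kerWeight ‖y‖) x‖ * ‖biotSavart2D w x‖ * 1 + kerWeight ‖x‖ * ‖biotSavart2D w x‖ * 1 + kerWeight ‖x‖ * ‖biotSavart2D (fun y => fderiv ℝ w y (EuclideanSpace.single i 1)) x‖ * 1) := by gcongr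
      _ = _ := by ring
  calc |(fderiv ℝ (fun y : EuclideanSpace ℝ (Fin 2) => Real.exp (a / 4 * ‖y‖ ^ 2) * (1 + ‖y‖ ^ 2)⁻¹) x (EuclideanSpace.single i 1) * (kerWeight ‖x‖ * ⟪biotSavart2D w x, x⟫) + (Real.exp (a / 4 * ‖x‖ ^ 2) * (1 + ‖x‖ ^ 2)⁻¹) * (fderiv ℝ (fun y : EuclideanSpace ℝ (Fin 2) => kerWeight ‖y‖) x (EuclideanSpace.single i 1) * ⟪biotSavart2D w x, x⟫ + kerWeight ‖x‖ * (⟪biotSavart2D w x, EuclideanSpace.single i 1⟫ + ⟪biotSavart2D (fun y => fderiv ℝ w y (EuclideanSpace.single i 1)) x, x⟫)))| ≤ |fderiv ℝ (fun y : EuclideanSpace ℝ (Fin 2) => Real.exp (a / 4 * ‖y‖ ^ 2) * (1 + ‖y‖ ^ 2)⁻¹) x (EuclideanSpace.single i 1) * (kerWeight ‖x‖ * ⟪biotSavart2D w x, x⟫)| + |(Real.exp (a / 4 * ‖x‖ ^ 2) * (1 + ‖x‖ ^ 2)⁻¹) * (fderiv ℝ (fun y : EuclideanSpace ℝ (Fin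 2) => kerWeight ‖y‖) x (EuclideanSpace.single i 1) * ⟪biotSavart2D w x, x⟫ + kerWeight ‖x‖ * (⟪biotSavart2D w x, EuclideanSpace.single i 1⟫ + ⟪biotSavart2D (fun y => fderiv ℝ w y (EuclideanSpace.single i 1)) x, x⟫))| :=
        abs_add_le _ _
    _ ≤ Real.exp (a / 4 * ‖x‖ ^ 2) * ((a / 2 + 2) * kerWeight ‖x‖ * ‖biotSavart2D w x‖) + Real.exp (a / 4 * ‖x‖ ^ 2) * (‖fderiv ℝ (fun y : EuclideanSpace ℝ (Fin 2) => kerWeight ‖y‖) x‖ * ‖biotSavart2D w x‖ + kerWeight ‖x‖ * ‖biotSavart2D w x‖ + kerWeight ‖x‖ * ‖biotSavart2D (fun y => fderiv ℝ w y (EuclideanSpace.single i 1)) x‖) :=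
        add_le_add h1 h2
    _ = _ := by ring

/-- **Bound of the correction part**: with the potential bounds (constant `C₁`) for `v`, `‖DΦ‖ v`
and `∂ᵢv = K ∗ ∂ᵢw`,
`|∫ pχ V (L+λM)w| ≤ (3((a/2+3)² + 1)C₁ + C₁ + (C₁+1)/2) ∫pw² + (3C₁ + 2) ∫p|∇w|²`. [folklore] -/
theorem abs_integral_gaussWeightChi_correctionV_mul_strained_le (ha : 0 ≤ a) {lam : ℝ}
    (hlam0 : 0 ≤ lam) (hlam1 : lam ≤ 1) {C₁ : ℝ} (hC₁ : 0 ≤ C₁)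
    (h4 : Integrable (fun x => Real.exp (a / 4 * ‖x‖ ^ 2) * kerWeight ‖x‖ ^ 2 * ‖biotSavart2D w x‖ ^ 2) ∧
      ∫ x, Real.exp (a / 4 * ‖x‖ ^ 2) * kerWeight ‖x‖ ^ 2 * ‖biotSavart2D w x‖ ^ 2 ≤ C₁ * ∫ x, Real.exp (a / 4 * ‖x‖ ^ 2) * w x ^ 2)
    (h5 : Integrable (fun x => Real.exp (a / 4 * ‖x‖ ^ 2) * ‖fderiv ℝ (fun y : EuclideanSpace ℝ (Fin 2) => kerWeight ‖y‖) x‖ ^ 2 * ‖biotSavart2D w x‖ ^ 2) ∧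
      ∫ x, Real.exp (a / 4 * ‖x‖ ^ 2) * ‖fderiv ℝ (fun y : EuclideanSpace ℝ (Fin 2) => kerWeight ‖y‖) x‖ ^ 2 * ‖biotSavart2D w x‖ ^ 2 ≤ C₁ * ∫ x, Real.exp (a / 4 * ‖x‖ ^ 2) * w x ^ 2)
    (h6 : ∀ i : Fin 2, Integrable (fun x => Real.exp (a / 4 * ‖x‖ ^ 2) * kerWeight ‖x‖ ^ 2 * ‖biotSavart2D (fun y => fderiv ℝ w y (EuclideanSpace.single i 1)) x‖ ^ 2) ∧
      ∫ x, Real.exp (a / 4 * ‖x‖ ^ 2) * kerWeight ‖x‖ ^ 2 * ‖biotSavart2D (fun y => fderiv ℝ w y (EuclideanSpace.single i 1)) x‖ ^ 2 ≤ C₁ * ∫ x, Real.exp (a / 4 * ‖x‖ ^ 2) * fderiv ℝ w x (EuclideanSpace.single i 1) ^ 2) :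
    |∫ x, (Real.exp (a / 4 * ‖x‖ ^ 2) * (1 + ‖x‖ ^ 2)⁻¹) * (kerWeight ‖x‖ * ⟪biotSavart2D w x, x⟫) * strainedVorticityOperator lam w x| ≤
      (3 * ((a / 2 + 3) ^ 2 + 1) * C₁ + C₁ + (C₁ + 1) / 2) * (∫ x, Real.exp (a / 4 * ‖x‖ ^ 2) * w x ^ 2) + (3 * C₁ + 2) * (∫ x, Real.exp (a / 4 * ‖x‖ ^ 2) * (fderiv ℝ w x (EuclideanSpace.single 0 1) ^ 2 + fderiv ℝ w x (EuclideanSpace.single 1 1) ^ 2)) := by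
  have hw1 : ContDiff ℝ 1 w := hw.of_le one_le_two
  have hdi : ∀ i : Fin 2, ContDiff ℝ 1 (fun y => fderiv ℝ w y (EuclideanSpace.single i 1)) := fun i =>
    (hw.fderiv_right (m := 1) (by norm_num)).clm_apply contDiff_const
  have hds : ∀ i : Fin 2, HasCompactSupport (fun y => fderiv ℝ w y (EuclideanSpace.single i 1)) := fun i => hwc.fderiv_apply (𝕜 := ℝ) _
  have hgc : ∀ i : Fin 2, Continuous (fun y => fderiv ℝ w y (EuclideanSpace.single i 1)) := fun i => (hdi i).continuous
  have hF := contDiff_gaussWeightChi a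
  have hFc := hF.continuous
  have hV := contDiff_one_correctionV hw hwc
  have hVc := hV.continuous
  have hpc : Continuous fun x : EuclideanSpace ℝ (Fin 2) => Real.exp (a / 4 * ‖x‖ ^ 2) := (contDiff_gaussWeightExp a (n := 0)).continuous
  have hpj : ∀ j : Fin 2, Continuous fun x : EuclideanSpace ℝ (Fin 2) => x j := fun j =>
    (EuclideanSpace.proj (j : Fin 2) : EuclideanSpace ℝ (Fin 2) →L[ℝ] ℝ).continuous
  have hΦc : Continuous fun x : EuclideanSpace ℝ (Fin 2) => kerWeight ‖x‖ := continuous_kerWeight.comp continuous_norm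
  have hΦ'c : Continuous fun x : EuclideanSpace ℝ (Fin 2) => fderiv ℝ (fun y : EuclideanSpace ℝ (Fin 2) => kerWeight ‖y‖) x := contDiff_kerWeight_norm.continuous_fderiv one_ne_zero
  have hvc : Continuous (biotSavart2D w) := (contDiff_biotSavart2D hw1 hwc).continuous
  have hdvc : ∀ i : Fin 2, Continuous (biotSavart2D (fun y => fderiv ℝ w y (EuclideanSpace.single i 1))) := fun i =>
    (contDiff_biotSavart2D (n := 0) (contDiff_zero.2 (hgc i)) (hds i)).continuous
  have hN0 : 0 ≤ ∫ x, Real.exp (a / 4 * ‖x‖ ^ 2) * w x ^ 2 := integral_nonneg fun x => by positivity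
  have hX0 : ∀ i : Fin 2, 0 ≤ ∫ x, Real.exp (a / 4 * ‖x‖ ^ 2) * fderiv ℝ w x (EuclideanSpace.single i 1) ^ 2 := fun i => integral_nonneg fun x => by positivity
  -- integrability
  have iNw : Integrable fun x : EuclideanSpace ℝ (Fin 2) => Real.exp (a / 4 * ‖x‖ ^ 2) * w x ^ 2 :=
    (integral_exp_eighth_mul_sq_le ha hw.continuous hwc).1
  have iX : ∀ i : Fin 2, Integrable fun x : EuclideanSpace ℝ (Fin 2) => Real.exp (a / 4 * ‖x‖ ^ 2) * fderiv ℝ w x (EuclideanSpace.single i 1) ^ 2 := by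
    intro i
    have : Integrable fun x : EuclideanSpace ℝ (Fin 2) => Real.exp (a / 4 * ‖x‖ ^ 2) * fderiv ℝ w x (EuclideanSpace.single i 1) * fderiv ℝ w x (EuclideanSpace.single i 1) :=
      integrable_mul_of_hasCompactSupport' (hpc.mul (hgc i)) (hgc i) (hds i)
    exact this.congr (Eventually.of_forall fun x => by beta_reduce; ring)
  have hX2eq : ∫ x, Real.exp (a / 4 * ‖x‖ ^ 2) * (fderiv ℝ w x (EuclideanSpace.single 0 1) ^ 2 + fderiv ℝ w x (EuclideanSpace.single 1 1) ^ 2) = (∫ x, Real.exp (a / 4 * ‖x‖ ^ 2) * fderiv ℝ w x (EuclideanSpace.single 0 1) ^ 2) + ∫ x, Real.exp (a / 4 * ‖x‖ ^ 2) * fderiv ℝ w x (EuclideanSpace.single 1 1) ^ 2 := by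
    rw [← integral_add (iX 0) (iX 1)]
    exact integral_congr_ae (Eventually.of_forall fun x => by beta_reduce; ring)
  have hX20 : 0 ≤ ∫ x, Real.exp (a / 4 * ‖x‖ ^ 2) * (fderiv ℝ w x (EuclideanSpace.single 0 1) ^ 2 + fderiv ℝ w x (EuclideanSpace.single 1 1) ^ 2) := integral_nonneg fun x => by positivity
  have hXi : ∀ i : Fin 2, ∫ x, Real.exp (a / 4 * ‖x‖ ^ 2) * fderiv ℝ w x (EuclideanSpace.single i 1) ^ 2 ≤ ∫ x, Real.exp (a / 4 * ‖x‖ ^ 2) * (fderiv ℝ w x (EuclideanSpace.single 0 1) ^ 2 + fderiv ℝ w x (EuclideanSpace.single 1 1) ^ 2) := by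
    intro i; rw [hX2eq]; fin_cases i
    · simpa using hX0 1
    · simpa using hX0 0
  have iΔ : Integrable fun x => (Real.exp (a / 4 * ‖x‖ ^ 2) * (1 + ‖x‖ ^ 2)⁻¹) * (kerWeight ‖x‖ * ⟪biotSavart2D w x, x⟫) * Δ w x := by
    have hΔ : (Δ w) = fun x => fderiv ℝ (fun y => fderiv ℝ w y (EuclideanSpace.single 0 1)) x (EuclideanSpace.single 0 1) +
        fderiv ℝ (fun y => fderiv ℝ w y (EuclideanSpace.single 1 1)) x (EuclideanSpace.single 1 1) := funext (laplacian_eq_fin_two_of_contDiff_two'' hw)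
    have hΔc : Continuous (Δ w) := by
      rw [hΔ]; exact (continuous_fderiv_fderiv_of_contDiff_two hw _ _).add
        (continuous_fderiv_fderiv_of_contDiff_two hw _ _)
    have hΔs : HasCompactSupport (Δ w) := by
      rw [hΔ]; exact ((hds 0).fderiv_apply (𝕜 := ℝ) _).add ((hds 1).fderiv_apply (𝕜 := ℝ) _)
    exact integrable_mul_of_hasCompactSupport' (hFc.mul hVc) hΔc hΔs
  have iD : ∀ i : Fin 2, Integrable fun x => (Real.exp (a / 4 * ‖x‖ ^ 2) * (1 + ‖x‖ ^ 2)⁻¹) * (kerWeight ‖x‖ * ⟪biotSavart2D w x, x⟫) * (x i * fderiv ℝ w x (EuclideanSpace.single i 1)) := by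
    intro i
    have : Integrable fun x => (Real.exp (a / 4 * ‖x‖ ^ 2) * (1 + ‖x‖ ^ 2)⁻¹) * (kerWeight ‖x‖ * ⟪biotSavart2D w x, x⟫) * x i * fderiv ℝ w x (EuclideanSpace.single i 1) :=
      integrable_mul_of_hasCompactSupport' ((hFc.mul hVc).mul (hpj i)) (hgc i) (hds i)
    exact this.congr (Eventually.of_forall fun x => by beta_reduce; ring)
  have iW : Integrable fun x => (Real.exp (a / 4 * ‖x‖ ^ 2) * (1 + ‖x‖ ^ 2)⁻¹) * (kerWeight ‖x‖ * ⟪biotSavart2D w x, x⟫) * w x :=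
    integrable_mul_of_hasCompactSupport' (hFc.mul hVc) hw.continuous hwc
  -- split
  have hsplit : ∫ x, (Real.exp (a / 4 * ‖x‖ ^ 2) * (1 + ‖x‖ ^ 2)⁻¹) * (kerWeight ‖x‖ * ⟪biotSavart2D w x, x⟫) * strainedVorticityOperator lam w x =
      (∫ x, (Real.exp (a / 4 * ‖x‖ ^ 2) * (1 + ‖x‖ ^ 2)⁻¹) * (kerWeight ‖x‖ * ⟪biotSavart2D w x, x⟫) * Δ w x) + (1 + lam) / 2 * (∫ x, (Real.exp (a / 4 * ‖x‖ ^ 2) * (1 + ‖x‖ ^ 2)⁻¹) * (kerWeight ‖x‖ * ⟪biotSavart2D w x, x⟫) * (x 0 * fderiv ℝ w x (EuclideanSpace.single 0 1))) +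
      (1 - lam) / 2 * (∫ x, (Real.exp (a / 4 * ‖x‖ ^ 2) * (1 + ‖x‖ ^ 2)⁻¹) * (kerWeight ‖x‖ * ⟪biotSavart2D w x, x⟫) * (x 1 * fderiv ℝ w x (EuclideanSpace.single 1 1))) + ∫ x, (Real.exp (a / 4 * ‖x‖ ^ 2) * (1 + ‖x‖ ^ 2)⁻¹) * (kerWeight ‖x‖ * ⟪biotSavart2D w x, x⟫) * w x := by
    have k1 : Integrable fun x => (1 + lam) / 2 * ((Real.exp (a / 4 * ‖x‖ ^ 2) * (1 + ‖x‖ ^ 2)⁻¹) * (kerWeight ‖x‖ * ⟪biotSavart2D w x, x⟫) * (x 0 * fderiv ℝ w x (EuclideanSpace.single 0 1))) := (iD 0).const_mul _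
    have k2 : Integrable fun x => (1 - lam) / 2 * ((Real.exp (a / 4 * ‖x‖ ^ 2) * (1 + ‖x‖ ^ 2)⁻¹) * (kerWeight ‖x‖ * ⟪biotSavart2D w x, x⟫) * (x 1 * fderiv ℝ w x (EuclideanSpace.single 1 1))) := (iD 1).const_mul _
    have hF2 : Integrable fun x => (Real.exp (a / 4 * ‖x‖ ^ 2) * (1 + ‖x‖ ^ 2)⁻¹) * (kerWeight ‖x‖ * ⟪biotSavart2D w x, x⟫) * Δ w x + (1 + lam) / 2 * ((Real.exp (a / 4 * ‖x‖ ^ 2) * (1 + ‖x‖ ^ 2)⁻¹) * (kerWeight ‖x‖ * ⟪biotSavart2D w x, x⟫) * (x 0 * fderiv ℝ w x (EuclideanSpace.single 0 1))) :=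
      iΔ.add k1
    have hF3 : Integrable fun x => (Real.exp (a / 4 * ‖x‖ ^ 2) * (1 + ‖x‖ ^ 2)⁻¹) * (kerWeight ‖x‖ * ⟪biotSavart2D w x, x⟫) * Δ w x + (1 + lam) / 2 * ((Real.exp (a / 4 * ‖x‖ ^ 2) * (1 + ‖x‖ ^ 2)⁻¹) * (kerWeight ‖x‖ * ⟪biotSavart2D w x, x⟫) * (x 0 * fderiv ℝ w x (EuclideanSpace.single 0 1))) +
        (1 - lam) / 2 * ((Real.exp (a / 4 * ‖x‖ ^ 2) * (1 + ‖x‖ ^ 2)⁻¹) * (kerWeight ‖x‖ * ⟪biotSavart2D w x, x⟫) * (x 1 * fderiv ℝ w x (EuclideanSpace.single 1 1))) := hF2.add k2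
    rw [← integral_const_mul, ← integral_const_mul, ← integral_add iΔ k1, ← integral_add hF2 k2,
      ← integral_add hF3 iW]
    refine integral_congr_ae (Eventually.of_forall fun x => ?_)
    simp only [strainedVorticityOperator]
    ring
  -- the pointwise bound `P Φ |v| |g|`-type Cauchy–Schwarz
  have hΦv : ∀ (g : EuclideanSpace ℝ (Fin 2) → ℝ), Continuous g →
      Integrable (fun x => Real.exp (a / 4 * ‖x‖ ^ 2) * g x ^ 2) →
      |∫ x, Real.exp (a / 4 * ‖x‖ ^ 2) * (kerWeight ‖x‖ * ‖biotSavart2D w x‖) * abs (g x)| ≤ Real.sqrt (C₁ * ∫ x, Real.exp (a / 4 * ‖x‖ ^ 2) * w x ^ 2) * Real.sqrt (∫ x, Real.exp (a / 4 * ‖x‖ ^ 2) * g x ^ 2) := by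
    intro g hg hgi
    have iA : Integrable fun x => Real.exp (a / 4 * ‖x‖ ^ 2) * (kerWeight ‖x‖ * ‖biotSavart2D w x‖) ^ 2 :=
      h4.1.congr (Eventually.of_forall fun x => by beta_reduce; ring)
    have hA : ∫ x, Real.exp (a / 4 * ‖x‖ ^ 2) * (kerWeight ‖x‖ * ‖biotSavart2D w x‖) ^ 2 ≤ C₁ * ∫ x, Real.exp (a / 4 * ‖x‖ ^ 2) * w x ^ 2 := by
      calc ∫ x, Real.exp (a / 4 * ‖x‖ ^ 2) * (kerWeight ‖x‖ * ‖biotSavart2D w x‖) ^ 2 = ∫ x, Real.exp (a / 4 * ‖x‖ ^ 2) * kerWeight ‖x‖ ^ 2 * ‖biotSavart2D w x‖ ^ 2 :=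
            integral_congr_ae (Eventually.of_forall fun x => by beta_reduce; ring)
        _ ≤ _ := h4.2
    have hgi' : Integrable fun x => Real.exp (a / 4 * ‖x‖ ^ 2) * |g x| ^ 2 := hgi.congr (Eventually.of_forall fun x => by
      beta_reduce; rw [sq_abs])
    have h := abs_integral_gaussWeight_mul_mul_le_sqrt (fun x => (Real.exp_pos _).le) hpc.measurable
      (hΦc.mul hvc.norm).measurable hg.abs.measurable iA hgi'
    have heq : ∫ x, Real.exp (a / 4 * ‖x‖ ^ 2) * |g x| ^ 2 = ∫ x, Real.exp (a / 4 * ‖x‖ ^ 2) * g x ^ 2 :=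
      integral_congr_ae (Eventually.of_forall fun x => by beta_reduce; rw [sq_abs])
    rw [heq] at h
    exact h.trans (mul_le_mul_of_nonneg_right (Real.sqrt_le_sqrt hA) (Real.sqrt_nonneg _))
  -- the Laplacian term
  have hΔb : |∫ x, (Real.exp (a / 4 * ‖x‖ ^ 2) * (1 + ‖x‖ ^ 2)⁻¹) * (kerWeight ‖x‖ * ⟪biotSavart2D w x, x⟫) * Δ w x| ≤
      (3 * ((a / 2 + 3) ^ 2 + 1) * C₁) * (∫ x, Real.exp (a / 4 * ‖x‖ ^ 2) * w x ^ 2) + (3 * C₁ + 1) * (∫ x, Real.exp (a / 4 * ‖x‖ ^ 2) * (fderiv ℝ w x (EuclideanSpace.single 0 1) ^ 2 + fderiv ℝ w x (EuclideanSpace.single 1 1) ^ 2)) := by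
    rw [integral_gaussWeightChi_correctionV_mul_laplacian_eq hw hwc, abs_neg]
    -- the integrand and its majorant
    have hBc : ∀ i : Fin 2, Continuous fun x : EuclideanSpace ℝ (Fin 2) => (fderiv ℝ (fun y : EuclideanSpace ℝ (Fin 2) => Real.exp (a / 4 * ‖y‖ ^ 2) * (1 + ‖y‖ ^ 2)⁻¹) x (EuclideanSpace.single i 1) * (kerWeight ‖x‖ * ⟪biotSavart2D w x, x⟫) + (Real.exp (a / 4 * ‖x‖ ^ 2) * (1 + ‖x‖ ^ 2)⁻¹) * (fderiv ℝ (fun y : EuclideanSpace ℝ (Fin 2) => kerWeight ‖y‖) x (EuclideanSpace.single i 1) * ⟪biotSavart2D w x, x⟫ + kerWeight ‖x‖ * (⟪biotSavart2D w x, EuclideanSpace.single i 1⟫ + ⟪biotSavart2D (fun y => fderiv ℝ w y (EuclideanSpace.single i 1)) x, x⟫))) := by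
      intro i
      have h1 : Continuous fun x => fderiv ℝ (fun y : EuclideanSpace ℝ (Fin 2) => Real.exp (a / 4 * ‖y‖ ^ 2) * (1 + ‖y‖ ^ 2)⁻¹) x (EuclideanSpace.single i 1) :=
        (hF.continuous_fderiv one_ne_zero).clm_apply continuous_const
      have h2 : Continuous fun x : EuclideanSpace ℝ (Fin 2) => fderiv ℝ (fun y : EuclideanSpace ℝ (Fin 2) => kerWeight ‖y‖) x (EuclideanSpace.single i 1) := hΦ'c.clm_apply continuous_const
      have h3 : Continuous fun x : EuclideanSpace ℝ (Fin 2) => ⟪biotSavart2D w x, x⟫ := hvc.inner continuous_id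
      have h4' : Continuous fun x : EuclideanSpace ℝ (Fin 2) => ⟪biotSavart2D w x, EuclideanSpace.single i (1:ℝ)⟫ :=
        hvc.inner continuous_const
      have h5' : Continuous fun x : EuclideanSpace ℝ (Fin 2) => ⟪biotSavart2D (fun y => fderiv ℝ w y (EuclideanSpace.single i 1)) x, x⟫ := (hdvc i).inner continuous_id
      exact (h1.mul hVc).add ((hpc.mul ((continuous_const.add (continuous_norm.pow 2)).inv₀
        fun x => (by positivity : (0:ℝ) < 1 + ‖x‖ ^ 2).ne')).mul ((h2.mul h3).add (hΦc.mul (h4'.add h5'))))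
    have hbc : ∀ i : Fin 2, Continuous fun x : EuclideanSpace ℝ (Fin 2) => ((a / 2 + 3) * kerWeight ‖x‖ * ‖biotSavart2D w x‖ + ‖fderiv ℝ (fun y : EuclideanSpace ℝ (Fin 2) => kerWeight ‖y‖) x‖ * ‖biotSavart2D w x‖ + kerWeight ‖x‖ * ‖biotSavart2D (fun y => fderiv ℝ w y (EuclideanSpace.single i 1)) x‖) := fun i =>
      (((continuous_const.mul hΦc).mul hvc.norm).add (hΦ'c.norm.mul hvc.norm)).add (hΦc.mul (hdvc i).norm)
    have iBd : ∀ i : Fin 2, Integrable fun x => (fderiv ℝ (fun y : EuclideanSpace ℝ (Fin 2) => Real.exp (a / 4 * ‖y‖ ^ 2) * (1 + ‖y‖ ^ 2)⁻¹) x (EuclideanSpace.single i 1) * (kerWeight ‖x‖ * ⟪biotSavart2D w x, x⟫) + (Real.exp (a / 4 * ‖x‖ ^ 2) * (1 + ‖x‖ ^ 2)⁻¹) * (fderiv ℝ (fun y : EuclideanSpace ℝ (Fin 2) => kerWeight ‖y‖) x (EuclideanSpace.single i 1) * ⟪biotSavart2D w x, x⟫ + kerWeight ‖x‖ * (⟪biotSavart2D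 w x, EuclideanSpace.single i 1⟫ + ⟪biotSavart2D (fun y => fderiv ℝ w y (EuclideanSpace.single i 1)) x, x⟫))) * fderiv ℝ w x (EuclideanSpace.single i 1) := fun i =>
      integrable_mul_of_hasCompactSupport' (hBc i) (hgc i) (hds i)
    have ibd : ∀ i : Fin 2, Integrable fun x => Real.exp (a / 4 * ‖x‖ ^ 2) * ((a / 2 + 3) * kerWeight ‖x‖ * ‖biotSavart2D w x‖ + ‖fderiv ℝ (fun y : EuclideanSpace ℝ (Fin 2) => kerWeight ‖y‖) x‖ * ‖biotSavart2D w x‖ + kerWeight ‖x‖ * ‖biotSavart2D (fun y => fderiv ℝ w y (EuclideanSpace.single i 1)) x‖) * |fderiv ℝ w x (EuclideanSpace.single i 1)| := fun i =>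
      integrable_mul_of_hasCompactSupport' (hpc.mul (hbc i)) (hgc i).abs (hds i).norm
    -- `∫ P bᵢ² ≤ 3((a/2+3)² C₁ Nw + C₁ Nw + C₁ Xᵢ)`
    have hb2 : ∀ i : Fin 2, Integrable (fun x => Real.exp (a / 4 * ‖x‖ ^ 2) * ((a / 2 + 3) * kerWeight ‖x‖ * ‖biotSavart2D w x‖ + ‖fderiv ℝ (fun y : EuclideanSpace ℝ (Fin 2) => kerWeight ‖y‖) x‖ * ‖biotSavart2D w x‖ + kerWeight ‖x‖ * ‖biotSavart2D (fun y => fderiv ℝ w y (EuclideanSpace.single i 1)) x‖) ^ 2) ∧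
        ∫ x, Real.exp (a / 4 * ‖x‖ ^ 2) * ((a / 2 + 3) * kerWeight ‖x‖ * ‖biotSavart2D w x‖ + ‖fderiv ℝ (fun y : EuclideanSpace ℝ (Fin 2) => kerWeight ‖y‖) x‖ * ‖biotSavart2D w x‖ + kerWeight ‖x‖ * ‖biotSavart2D (fun y => fderiv ℝ w y (EuclideanSpace.single i 1)) x‖) ^ 2 ≤ 3 * ((a / 2 + 3) ^ 2 * (C₁ * ∫ x, Real.exp (a / 4 * ‖x‖ ^ 2) * w x ^ 2) + C₁ * (∫ x, Real.exp (a / 4 * ‖x‖ ^ 2) * w x ^ 2) + C₁ * (∫ x, Real.exp (a / 4 * ‖x‖ ^ 2) * fderiv ℝ w x (EuclideanSpace.single i 1) ^ 2)) := by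
      intro i
      have hmaj : Integrable fun x => 3 * ((a / 2 + 3) ^ 2 * (Real.exp (a / 4 * ‖x‖ ^ 2) * kerWeight ‖x‖ ^ 2 * ‖biotSavart2D w x‖ ^ 2) +
          Real.exp (a / 4 * ‖x‖ ^ 2) * ‖fderiv ℝ (fun y : EuclideanSpace ℝ (Fin 2) => kerWeight ‖y‖) x‖ ^ 2 * ‖biotSavart2D w x‖ ^ 2 + Real.exp (a / 4 * ‖x‖ ^ 2) * kerWeight ‖x‖ ^ 2 * ‖biotSavart2D (fun y => fderiv ℝ w y (EuclideanSpace.single i 1)) x‖ ^ 2) :=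
        (((h4.1.const_mul _).add h5.1).add (h6 i).1).const_mul 3
      have hpt : ∀ x : EuclideanSpace ℝ (Fin 2), Real.exp (a / 4 * ‖x‖ ^ 2) * ((a / 2 + 3) * kerWeight ‖x‖ * ‖biotSavart2D w x‖ + ‖fderiv ℝ (fun y : EuclideanSpace ℝ (Fin 2) => kerWeight ‖y‖) x‖ * ‖biotSavart2D w x‖ + kerWeight ‖x‖ * ‖biotSavart2D (fun y => fderiv ℝ w y (EuclideanSpace.single i 1)) x‖) ^ 2 ≤ 3 * ((a / 2 + 3) ^ 2 * (Real.exp (a / 4 * ‖x‖ ^ 2) * kerWeight ‖x‖ ^ 2 * ‖biotSavart2D w x‖ ^ 2) +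
          Real.exp (a / 4 * ‖x‖ ^ 2) * ‖fderiv ℝ (fun y : EuclideanSpace ℝ (Fin 2) => kerWeight ‖y‖) x‖ ^ 2 * ‖biotSavart2D w x‖ ^ 2 + Real.exp (a / 4 * ‖x‖ ^ 2) * kerWeight ‖x‖ ^ 2 * ‖biotSavart2D (fun y => fderiv ℝ w y (EuclideanSpace.single i 1)) x‖ ^ 2) := by
        intro x
        have hP0 : 0 < Real.exp (a / 4 * ‖x‖ ^ 2) := Real.exp_pos _
        set t₁ := (a / 2 + 3) * kerWeight ‖x‖ * ‖biotSavart2D w x‖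
        set t₂ := ‖fderiv ℝ (fun y : EuclideanSpace ℝ (Fin 2) => kerWeight ‖y‖) x‖ * ‖biotSavart2D w x‖
        set t₃ := kerWeight ‖x‖ * ‖biotSavart2D (fun y => fderiv ℝ w y (EuclideanSpace.single i 1)) x‖
        have h3 : (t₁ + t₂ + t₃) ^ 2 ≤ 3 * (t₁ ^ 2 + t₂ ^ 2 + t₃ ^ 2) := by
          nlinarith [sq_nonneg (t₁ - t₂), sq_nonneg (t₁ - t₃), sq_nonneg (t₂ - t₃)]
        calc Real.exp (a / 4 * ‖x‖ ^ 2) * (t₁ + t₂ + t₃) ^ 2 ≤ Real.exp (a / 4 * ‖x‖ ^ 2) * (3 * (t₁ ^ 2 + t₂ ^ 2 + t₃ ^ 2)) :=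
            mul_le_mul_of_nonneg_left h3 hP0.le
          _ = _ := by simp only [t₁, t₂, t₃]; ring
      have iA : Integrable fun x => Real.exp (a / 4 * ‖x‖ ^ 2) * ((a / 2 + 3) * kerWeight ‖x‖ * ‖biotSavart2D w x‖ + ‖fderiv ℝ (fun y : EuclideanSpace ℝ (Fin 2) => kerWeight ‖y‖) x‖ * ‖biotSavart2D w x‖ + kerWeight ‖x‖ * ‖biotSavart2D (fun y => fderiv ℝ w y (EuclideanSpace.single i 1)) x‖) ^ 2 :=
        hmaj.mono' (hpc.mul ((hbc i).pow 2)).aestronglyMeasurable (Eventually.of_forall fun x => by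
          rw [Real.norm_of_nonneg (by positivity)]; exact hpt x)
      refine ⟨iA, (integral_mono iA hmaj hpt).trans ?_⟩
      have i12 : Integrable fun x => (a / 2 + 3) ^ 2 * (Real.exp (a / 4 * ‖x‖ ^ 2) * kerWeight ‖x‖ ^ 2 * ‖biotSavart2D w x‖ ^ 2) +
          Real.exp (a / 4 * ‖x‖ ^ 2) * ‖fderiv ℝ (fun y : EuclideanSpace ℝ (Fin 2) => kerWeight ‖y‖) x‖ ^ 2 * ‖biotSavart2D w x‖ ^ 2 := (h4.1.const_mul _).add h5.1
      rw [integral_const_mul, integral_add (i12) (h6 i).1, integral_add (h4.1.const_mul _) h5.1,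
        integral_const_mul]
      have k4 := mul_le_mul_of_nonneg_left h4.2 (sq_nonneg (a / 2 + 3))
      have k5 := h5.2; have k6 := (h6 i).2
      linarith
    -- each `i`
    have hTi : ∀ i : Fin 2, ∫ x, Real.exp (a / 4 * ‖x‖ ^ 2) * ((a / 2 + 3) * kerWeight ‖x‖ * ‖biotSavart2D w x‖ + ‖fderiv ℝ (fun y : EuclideanSpace ℝ (Fin 2) => kerWeight ‖y‖) x‖ * ‖biotSavart2D w x‖ + kerWeight ‖x‖ * ‖biotSavart2D (fun y => fderiv ℝ w y (EuclideanSpace.single i 1)) x‖) * |fderiv ℝ w x (EuclideanSpace.single i 1)| ≤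
        Real.sqrt (3 * ((a / 2 + 3) ^ 2 * (C₁ * ∫ x, Real.exp (a / 4 * ‖x‖ ^ 2) * w x ^ 2) + C₁ * (∫ x, Real.exp (a / 4 * ‖x‖ ^ 2) * w x ^ 2) + C₁ * (∫ x, Real.exp (a / 4 * ‖x‖ ^ 2) * fderiv ℝ w x (EuclideanSpace.single i 1) ^ 2))) *
          Real.sqrt (∫ x, Real.exp (a / 4 * ‖x‖ ^ 2) * fderiv ℝ w x (EuclideanSpace.single i 1) ^ 2) := by
      intro i
      have iXa : Integrable fun x => Real.exp (a / 4 * ‖x‖ ^ 2) * |fderiv ℝ w x (EuclideanSpace.single i 1)| ^ 2 := (iX i).congr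
        (Eventually.of_forall fun x => by beta_reduce; rw [sq_abs])
      have h := abs_integral_gaussWeight_mul_mul_le_sqrt (fun x => (Real.exp_pos _).le) hpc.measurable
        (hbc i).measurable (hgc i).abs.measurable (hb2 i).1 iXa
      have heq : ∫ x, Real.exp (a / 4 * ‖x‖ ^ 2) * |fderiv ℝ w x (EuclideanSpace.single i 1)| ^ 2 = ∫ x, Real.exp (a / 4 * ‖x‖ ^ 2) * fderiv ℝ w x (EuclideanSpace.single i 1) ^ 2 :=
        integral_congr_ae (Eventually.of_forall fun x => by beta_reduce; rw [sq_abs])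
      rw [heq] at h
      exact (le_abs_self _).trans (h.trans (mul_le_mul_of_nonneg_right (Real.sqrt_le_sqrt (hb2 i).2)
        (Real.sqrt_nonneg _)))
    -- sum and AM–GM
    have hsum : |∫ x, (fderiv ℝ (fun y : EuclideanSpace ℝ (Fin 2) => Real.exp (a / 4 * ‖y‖ ^ 2) * (1 + ‖y‖ ^ 2)⁻¹) x (EuclideanSpace.single 0 1) * (kerWeight ‖x‖ * ⟪biotSavart2D w x, x⟫) + (Real.exp (a / 4 * ‖x‖ ^ 2) * (1 + ‖x‖ ^ 2)⁻¹) * (fderiv ℝ (fun y : EuclideanSpace ℝ (Fin 2) => kerWeight ‖y‖) x (EuclideanSpace.single 0 1) * ⟪biotSavart2D w x, x⟫ + kerWeight ‖x‖ * (⟪biotSavart2D w x, EuclideanSpace.single 0 1⟫ + ⟪biotSavart2D (fun y => fderiv ℝ w y (EuclideanSpace.single 0 1)) x, x⟫))) * fderiv ℝ w x (EuclideanSpace.single 0 1) + (fderiv ℝ (fun y : EuclideanSpace ℝ (Fin 2) => Real.exp (a / 4 * ‖y‖ ^ 2) * (1 + ‖y‖ ^ 2)⁻¹) x (EuclideanSpace.single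 1 1) * (kerWeight ‖x‖ * ⟪biotSavart2D w x, x⟫) + (Real.exp (a / 4 * ‖x‖ ^ 2) * (1 + ‖x‖ ^ 2)⁻¹) * (fderiv ℝ (fun y : EuclideanSpace ℝ (Fin 2) => kerWeight ‖y‖) x (EuclideanSpace.single 1 1) * ⟪biotSavart2D w x, x⟫ + kerWeight ‖x‖ * (⟪biotSavart2D w x, EuclideanSpace.single 1 1⟫ + ⟪biotSavart2D (fun y => fderiv ℝ w y (EuclideanSpace.single 1 1)) x, x⟫))) * fderiv ℝ w x (EuclideanSpace.single 1 1)| ≤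
        (∫ x, Real.exp (a / 4 * ‖x‖ ^ 2) * ((a / 2 + 3) * kerWeight ‖x‖ * ‖biotSavart2D w x‖ + ‖fderiv ℝ (fun y : EuclideanSpace ℝ (Fin 2) => kerWeight ‖y‖) x‖ * ‖biotSavart2D w x‖ + kerWeight ‖x‖ * ‖biotSavart2D (fun y => fderiv ℝ w y (EuclideanSpace.single 0 1)) x‖) * |fderiv ℝ w x (EuclideanSpace.single 0 1)|) + ∫ x, Real.exp (a / 4 * ‖x‖ ^ 2) * ((a / 2 + 3) * kerWeight ‖x‖ * ‖biotSavart2D w x‖ + ‖fderiv ℝ (fun y : EuclideanSpace ℝ (Fin 2) => kerWeight ‖y‖) x‖ * ‖biotSavart2D w x‖ + kerWeight ‖x‖ * ‖biotSavart2D (fun y => fderiv ℝ w y (EuclideanSpace.single 1 1)) x‖) * |fderiv ℝ w x (EuclideanSpace.single 1 1)| := by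
      rw [← integral_add (ibd 0) (ibd 1)]
      refine abs_integral_le_integral_abs.trans (integral_mono ((iBd 0).add (iBd 1)).abs ((ibd 0).add (ibd 1))
        fun x => ?_)
      have e0 := abs_correctionB_le (w := w) ha x 0
      have e1 := abs_correctionB_le (w := w) ha x 1
      calc _ ≤ |(fderiv ℝ (fun y : EuclideanSpace ℝ (Fin 2) => Real.exp (a / 4 * ‖y‖ ^ 2) * (1 + ‖y‖ ^ 2)⁻¹) x (EuclideanSpace.single 0 1) * (kerWeight ‖x‖ * ⟪biotSavart2D w x, x⟫) + (Real.exp (a / 4 * ‖x‖ ^ 2) * (1 + ‖x‖ ^ 2)⁻¹) * (fderiv ℝ (fun y : EuclideanSpace ℝ (Fin 2) => kerWeight ‖y‖) x (EuclideanSpace.single 0 1) * ⟪biotSavart2D w x, x⟫ + kerWeight ‖x‖ * (⟪biotSavart2D w x, EuclideanSpace.single 0 1⟫ + ⟪biotSavart2D (fun y => fderiv ℝ w y (EuclideanSpace.single 0 1)) x, x⟫))) * fderiv ℝ w x (EuclideanSpace.single 0 1)| + |(fderiv ℝ (fun y : EuclideanSpace ℝ (Fin 2) => Real.exp (a / 4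 * ‖y‖ ^ 2) * (1 + ‖y‖ ^ 2)⁻¹) x (EuclideanSpace.single 1 1) * (kerWeight ‖x‖ * ⟪biotSavart2D w x, x⟫) + (Real.exp (a / 4 * ‖x‖ ^ 2) * (1 + ‖x‖ ^ 2)⁻¹) * (fderiv ℝ (fun y : EuclideanSpace ℝ (Fin 2) => kerWeight ‖y‖) x (EuclideanSpace.single 1 1) * ⟪biotSavart2D w x, x⟫ + kerWeight ‖x‖ * (⟪biotSavart2D w x, EuclideanSpace.single 1 1⟫ + ⟪biotSavart2D (fun y => fderiv ℝ w y (EuclideanSpace.single 1 1)) x, x⟫))) * fderiv ℝ w x (EuclideanSpace.single 1 1)| := abs_add_le _ _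
        _ = |(fderiv ℝ (fun y : EuclideanSpace ℝ (Fin 2) => Real.exp (a / 4 * ‖y‖ ^ 2) * (1 + ‖y‖ ^ 2)⁻¹) x (EuclideanSpace.single 0 1) * (kerWeight ‖x‖ * ⟪biotSavart2D w x, x⟫) + (Real.exp (a / 4 * ‖x‖ ^ 2) * (1 + ‖x‖ ^ 2)⁻¹) * (fderiv ℝ (fun y : EuclideanSpace ℝ (Fin 2) => kerWeight ‖y‖) x (EuclideanSpace.single 0 1) * ⟪biotSavart2D w x, x⟫ + kerWeight ‖x‖ * (⟪biotSavart2D w x, EuclideanSpace.single 0 1⟫ + ⟪biotSavart2D (fun y => fderiv ℝ w y (EuclideanSpace.single 0 1)) x, x⟫)))| * |fderiv ℝ w x (EuclideanSpace.single 0 1)| + |(fderiv ℝ (fun y : EuclideanSpace ℝ (Fin 2) => Real.exp (a / 4 * ‖y‖ ^ 2) * (1 + ‖y‖ ^ 2)⁻¹) x (EuclideanSpace.single 1 1) * (kerWeight ‖x‖ * ⟪biotSavart2D w x, x⟫) + (Real.exp (a / 4 * ‖x‖ ^ 2) * (1 + ‖x‖ ^ 2)⁻¹) * (fderiv ℝ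 (fun y : EuclideanSpace ℝ (Fin 2) => kerWeight ‖y‖) x (EuclideanSpace.single 1 1) * ⟪biotSavart2D w x, x⟫ + kerWeight ‖x‖ * (⟪biotSavart2D w x, EuclideanSpace.single 1 1⟫ + ⟪biotSavart2D (fun y => fderiv ℝ w y (EuclideanSpace.single 1 1)) x, x⟫)))| * |fderiv ℝ w x (EuclideanSpace.single 1 1)| := by rw [abs_mul, abs_mul]
        _ ≤ _ := add_le_add (mul_le_mul_of_nonneg_right e0 (abs_nonneg _))
            (mul_le_mul_of_nonneg_right e1 (abs_nonneg _))
    have hA0 : ∀ i : Fin 2, 0 ≤ 3 * ((a / 2 + 3) ^ 2 * (C₁ * ∫ x, Real.exp (a / 4 * ‖x‖ ^ 2) * w x ^ 2) + C₁ * (∫ x, Real.exp (a / 4 * ‖x‖ ^ 2) * w x ^ 2) + C₁ * (∫ x, Real.exp (a / 4 * ‖x‖ ^ 2) * fderiv ℝ w x (EuclideanSpace.single i 1) ^ 2)) :=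
      fun i => by have := hX0 i; positivity
    have g0 := (hTi 0).trans (sqrt_mul_sqrt_le_half _ _ (hA0 0) (hX0 0))
    have g1 := (hTi 1).trans (sqrt_mul_sqrt_le_half _ _ (hA0 1) (hX0 1))
    refine hsum.trans ?_
    rw [hX2eq]
    have p0 := mul_nonneg hC₁ (hX0 0)
    have p1 := mul_nonneg hC₁ (hX0 1)
    linarith [g0, g1, hX0 0, hX0 1]
  -- drift terms
  have hDb : ∀ i : Fin 2, |∫ x, (Real.exp (a / 4 * ‖x‖ ^ 2) * (1 + ‖x‖ ^ 2)⁻¹) * (kerWeight ‖x‖ * ⟪biotSavart2D w x, x⟫) * (x i * fderiv ℝ w x (EuclideanSpace.single i 1))| ≤ Real.sqrt (C₁ * ∫ x, Real.exp (a / 4 * ‖x‖ ^ 2) * w x ^ 2) * Real.sqrt (∫ x, Real.exp (a / 4 * ‖x‖ ^ 2) * (fderiv ℝ w x (EuclideanSpace.single 0 1) ^ 2 + fderiv ℝ w x (EuclideanSpace.single 1 1) ^ 2)) := by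
    intro i
    have hpt : ∀ x : EuclideanSpace ℝ (Fin 2), |(Real.exp (a / 4 * ‖x‖ ^ 2) * (1 + ‖x‖ ^ 2)⁻¹) * (kerWeight ‖x‖ * ⟪biotSavart2D w x, x⟫) * (x i * fderiv ℝ w x (EuclideanSpace.single i 1))| ≤ Real.exp (a / 4 * ‖x‖ ^ 2) * (kerWeight ‖x‖ * ‖biotSavart2D w x‖) * |fderiv ℝ w x (EuclideanSpace.single i 1)| := by
      intro x
      obtain ⟨hχ0, hχ1, hχ2, hχ3⟩ := chi_bounds x
      have hP0 : 0 < Real.exp (a / 4 * ‖x‖ ^ 2) := Real.exp_pos _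
      have hΦ0 : 0 ≤ kerWeight ‖x‖ := (kerWeight_pos _).le
      have hxi : |x i| ≤ ‖x‖ := by simpa using PiLp.norm_apply_le x i
      have hvx : |⟪biotSavart2D w x, x⟫| ≤ ‖biotSavart2D w x‖ * ‖x‖ := abs_real_inner_le_norm _ _
      simp only [abs_mul, abs_of_pos hP0, abs_of_pos hχ0, abs_of_nonneg hΦ0]
      calc Real.exp (a / 4 * ‖x‖ ^ 2) * (1 + ‖x‖ ^ 2)⁻¹ * (kerWeight ‖x‖ * |⟪biotSavart2D w x, x⟫|) * (|x i| * |fderiv ℝ w x (EuclideanSpace.single i 1)|)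
          ≤ Real.exp (a / 4 * ‖x‖ ^ 2) * (1 + ‖x‖ ^ 2)⁻¹ * (kerWeight ‖x‖ * (‖biotSavart2D w x‖ * ‖x‖)) * (‖x‖ * |fderiv ℝ w x (EuclideanSpace.single i 1)|) := by gcongr
        _ = Real.exp (a / 4 * ‖x‖ ^ 2) * (kerWeight ‖x‖ * ‖biotSavart2D w x‖) * |fderiv ℝ w x (EuclideanSpace.single i 1)| * ((1 + ‖x‖ ^ 2)⁻¹ * ‖x‖ ^ 2) := by ring
        _ ≤ Real.exp (a / 4 * ‖x‖ ^ 2) * (kerWeight ‖x‖ * ‖biotSavart2D w x‖) * |fderiv ℝ w x (EuclideanSpace.single i 1)| * 1 := by gcongr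
        _ = _ := mul_one _
    have ib : Integrable fun x => Real.exp (a / 4 * ‖x‖ ^ 2) * (kerWeight ‖x‖ * ‖biotSavart2D w x‖) * |fderiv ℝ w x (EuclideanSpace.single i 1)| :=
      integrable_mul_of_hasCompactSupport' (hpc.mul (hΦc.mul hvc.norm)) (hgc i).abs (hds i).norm
    calc |∫ x, (Real.exp (a / 4 * ‖x‖ ^ 2) * (1 + ‖x‖ ^ 2)⁻¹) * (kerWeight ‖x‖ * ⟪biotSavart2D w x, x⟫) * (x i * fderiv ℝ w x (EuclideanSpace.single i 1))| ≤ ∫ x, |(Real.exp (a / 4 * ‖x‖ ^ 2) * (1 + ‖x‖ ^ 2)⁻¹) * (kerWeight ‖x‖ * ⟪biotSavart2D w x, x⟫) * (x i * fderiv ℝ w x (EuclideanSpace.single i 1))| :=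
          abs_integral_le_integral_abs
      _ ≤ ∫ x, Real.exp (a / 4 * ‖x‖ ^ 2) * (kerWeight ‖x‖ * ‖biotSavart2D w x‖) * |fderiv ℝ w x (EuclideanSpace.single i 1)| := integral_mono (iD i).abs ib hpt
      _ ≤ |∫ x, Real.exp (a / 4 * ‖x‖ ^ 2) * (kerWeight ‖x‖ * ‖biotSavart2D w x‖) * abs (fderiv ℝ w x (EuclideanSpace.single i 1))| := le_abs_self _
      _ ≤ Real.sqrt (C₁ * ∫ x, Real.exp (a / 4 * ‖x‖ ^ 2) * w x ^ 2) * Real.sqrt (∫ x, Real.exp (a / 4 * ‖x‖ ^ 2) * fderiv ℝ w x (EuclideanSpace.single i 1) ^ 2) := hΦv _ (hgc i) (iX i)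
      _ ≤ _ := mul_le_mul_of_nonneg_left (Real.sqrt_le_sqrt (hXi i)) (Real.sqrt_nonneg _)
  -- zero-order term
  have hWb : |∫ x, (Real.exp (a / 4 * ‖x‖ ^ 2) * (1 + ‖x‖ ^ 2)⁻¹) * (kerWeight ‖x‖ * ⟪biotSavart2D w x, x⟫) * w x| ≤ Real.sqrt (C₁ * ∫ x, Real.exp (a / 4 * ‖x‖ ^ 2) * w x ^ 2) * Real.sqrt (∫ x, Real.exp (a / 4 * ‖x‖ ^ 2) * w x ^ 2) := by
    have hpt : ∀ x : EuclideanSpace ℝ (Fin 2), |(Real.exp (a / 4 * ‖x‖ ^ 2) * (1 + ‖x‖ ^ 2)⁻¹) * (kerWeight ‖x‖ * ⟪biotSavart2D w x, x⟫) * w x| ≤ Real.exp (a / 4 * ‖x‖ ^ 2) * (kerWeight ‖x‖ * ‖biotSavart2D w x‖) * |w x| := by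
      intro x
      obtain ⟨hχ0, hχ1, hχ2, hχ3⟩ := chi_bounds x
      have hP0 : 0 < Real.exp (a / 4 * ‖x‖ ^ 2) := Real.exp_pos _
      have hΦ0 : 0 ≤ kerWeight ‖x‖ := (kerWeight_pos _).le
      have hvx : |⟪biotSavart2D w x, x⟫| ≤ ‖biotSavart2D w x‖ * ‖x‖ := abs_real_inner_le_norm _ _
      simp only [abs_mul, abs_of_pos hP0, abs_of_pos hχ0, abs_of_nonneg hΦ0]
      calc Real.exp (a / 4 * ‖x‖ ^ 2) * (1 + ‖x‖ ^ 2)⁻¹ * (kerWeight ‖x‖ * |⟪biotSavart2D w x, x⟫|) * |w x|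
          ≤ Real.exp (a / 4 * ‖x‖ ^ 2) * (1 + ‖x‖ ^ 2)⁻¹ * (kerWeight ‖x‖ * (‖biotSavart2D w x‖ * ‖x‖)) * |w x| := by gcongr
        _ = Real.exp (a / 4 * ‖x‖ ^ 2) * (kerWeight ‖x‖ * ‖biotSavart2D w x‖) * |w x| * ((1 + ‖x‖ ^ 2)⁻¹ * ‖x‖) := by ring
        _ ≤ Real.exp (a / 4 * ‖x‖ ^ 2) * (kerWeight ‖x‖ * ‖biotSavart2D w x‖) * |w x| * 1 := by gcongr
        _ = _ := mul_one _
    have ib : Integrable fun x => Real.exp (a / 4 * ‖x‖ ^ 2) * (kerWeight ‖x‖ * ‖biotSavart2D w x‖) * |w x| :=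
      integrable_mul_of_hasCompactSupport' (hpc.mul (hΦc.mul hvc.norm)) hw.continuous.abs hwc.norm
    calc |∫ x, (Real.exp (a / 4 * ‖x‖ ^ 2) * (1 + ‖x‖ ^ 2)⁻¹) * (kerWeight ‖x‖ * ⟪biotSavart2D w x, x⟫) * w x| ≤ ∫ x, |(Real.exp (a / 4 * ‖x‖ ^ 2) * (1 + ‖x‖ ^ 2)⁻¹) * (kerWeight ‖x‖ * ⟪biotSavart2D w x, x⟫) * w x| := abs_integral_le_integral_abs
      _ ≤ ∫ x, Real.exp (a / 4 * ‖x‖ ^ 2) * (kerWeight ‖x‖ * ‖biotSavart2D w x‖) * |w x| := integral_mono iW.abs ib hpt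
      _ ≤ |∫ x, Real.exp (a / 4 * ‖x‖ ^ 2) * (kerWeight ‖x‖ * ‖biotSavart2D w x‖) * abs (w x)| := le_abs_self _
      _ ≤ _ := hΦv _ hw.continuous iNw
  -- assemble with AM–GM
  have hCN : 0 ≤ C₁ * ∫ x, Real.exp (a / 4 * ‖x‖ ^ 2) * w x ^ 2 := mul_nonneg hC₁ hN0
  have d0 := (hDb 0).trans (sqrt_mul_sqrt_le_half _ _ hCN hX20)
  have d1 := (hDb 1).trans (sqrt_mul_sqrt_le_half _ _ hCN hX20)
  have dw := hWb.trans (sqrt_mul_sqrt_le_half _ _ hCN hN0)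
  rw [hsplit]
  refine (abs_add_four_le_aux _ _ _ _).trans ?_
  have c0 : |(1 + lam) / 2 * ∫ x, (Real.exp (a / 4 * ‖x‖ ^ 2) * (1 + ‖x‖ ^ 2)⁻¹) * (kerWeight ‖x‖ * ⟪biotSavart2D w x, x⟫) * (x 0 * fderiv ℝ w x (EuclideanSpace.single 0 1))| ≤ (C₁ * (∫ x, Real.exp (a / 4 * ‖x‖ ^ 2) * w x ^ 2) + ∫ x, Real.exp (a / 4 * ‖x‖ ^ 2) * (fderiv ℝ w x (EuclideanSpace.single 0 1) ^ 2 + fderiv ℝ w x (EuclideanSpace.single 1 1) ^ 2)) / 2 := by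
    rw [abs_mul, abs_of_nonneg (by linarith only [hlam0, hlam1])]
    calc _ ≤ 1 * ((C₁ * (∫ x, Real.exp (a / 4 * ‖x‖ ^ 2) * w x ^ 2) + ∫ x, Real.exp (a / 4 * ‖x‖ ^ 2) * (fderiv ℝ w x (EuclideanSpace.single 0 1) ^ 2 + fderiv ℝ w x (EuclideanSpace.single 1 1) ^ 2)) / 2) := mul_le_mul (by linarith only [hlam0, hlam1]) d0 (abs_nonneg _) zero_le_one
      _ = _ := one_mul _
  have c1 : |(1 - lam) / 2 * ∫ x, (Real.exp (a / 4 * ‖x‖ ^ 2) * (1 + ‖x‖ ^ 2)⁻¹) * (kerWeight ‖x‖ * ⟪biotSavart2D w x, x⟫) * (x 1 * fderiv ℝ w x (EuclideanSpace.single 1 1))| ≤ (C₁ * (∫ x, Real.exp (a / 4 * ‖x‖ ^ 2) * w x ^ 2) + ∫ x, Real.exp (a / 4 * ‖x‖ ^ 2) * (fderiv ℝ w x (EuclideanSpace.single 0 1) ^ 2 + fderiv ℝ w x (EuclideanSpace.single 1 1) ^ 2)) / 2 := by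
    rw [abs_mul, abs_of_nonneg (by linarith only [hlam0, hlam1])]
    calc _ ≤ 1 * ((C₁ * (∫ x, Real.exp (a / 4 * ‖x‖ ^ 2) * w x ^ 2) + ∫ x, Real.exp (a / 4 * ‖x‖ ^ 2) * (fderiv ℝ w x (EuclideanSpace.single 0 1) ^ 2 + fderiv ℝ w x (EuclideanSpace.single 1 1) ^ 2)) / 2) := mul_le_mul (by linarith only [hlam0, hlam1]) d1 (abs_nonneg _) zero_le_one
      _ = _ := one_mul _
  linarith only [hΔb, c0, c1, dw]

end VPart

/-! ### The multiplier identity and the `f`-term -/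

section Identity

variable {w : EuclideanSpace ℝ (Fin 2) → ℝ} (hw : ContDiff ℝ 2 w) (hwc : HasCompactSupport w) {a : ℝ}
include hw hwc

/-- `∂_θ(w + Φψ) = ∂_θw − Φ⟪v, x⟫` (`∂_θΦ = 0`, `∂_θψ = −⟪v, x⟫`). [folklore] -/
theorem fderiv_corrected_perp_eq (x : EuclideanSpace ℝ (Fin 2)) : fderiv ℝ (fun y => w y + kerWeight ‖y‖ * ∫ z, w z * ((2 * π)⁻¹ * Real.log ‖y - z‖)) x (perp x) = fderiv ℝ w x (perp x) - (kerWeight ‖x‖ * ⟪biotSavart2D w x, x⟫) := by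
  have hw1 : ContDiff ℝ 1 w := hw.of_le one_le_two
  have hψ1 : ContDiff ℝ 1 (fun y => ∫ z, w z * ((2 * π)⁻¹ * Real.log ‖y - z‖)) := contDiff_logPotential (n := 1) hw1 hwc
  have hw' : HasFDerivAt w (fderiv ℝ w x) x := ((hw1.differentiable one_ne_zero) x).hasFDerivAt
  have hψ' : HasFDerivAt (fun y => ∫ z, w z * ((2 * π)⁻¹ * Real.log ‖y - z‖)) (fderiv ℝ (fun y => ∫ z, w z * ((2 * π)⁻¹ * Real.log ‖y - z‖)) x) x := ((hψ1.differentiable one_ne_zero) x).hasFDerivAt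
  have hΦ' : HasFDerivAt (fun y : EuclideanSpace ℝ (Fin 2) => kerWeight ‖y‖) (fderiv ℝ (fun y : EuclideanSpace ℝ (Fin 2) => kerWeight ‖y‖) x) x := (differentiableAt_kerWeight_norm x).hasFDerivAt
  rw [(hw'.fun_add (hΦ'.fun_mul hψ')).fderiv]
  simp only [_root_.add_apply, _root_.smul_apply, smul_eq_mul, fderiv_kerWeight_norm_perp,
    fderiv_logPotential_eq hw1 hwc, inner_perp_perp]
  ring

/-- `pχΩ(∂_θu)²` is integrable (`a < 2`). [folklore] -/
theorem integrable_gaussWeightChi_omega_mul_sq (ha2 : a < 2) :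
    Integrable fun x => (Real.exp (a / 4 * ‖x‖ ^ 2) * (1 + ‖x‖ ^ 2)⁻¹) * (gaussVortexProfile x / (2 * kerWeight ‖x‖)) * (fderiv ℝ (fun y => w y + kerWeight ‖y‖ * ∫ z, w z * ((2 * π)⁻¹ * Real.log ‖y - z‖)) x (perp x)) ^ 2 := by
  obtain ⟨Cu, hCu0, hCu⟩ := exists_corrected_gauss_bound hw hwc
  have hμ : (a - 2) / 4 < 0 := by linarith
  have hu1 := contDiff_one_corrected hw hwc
  have hc : Continuous fun x => (Real.exp (a / 4 * ‖x‖ ^ 2) * (1 + ‖x‖ ^ 2)⁻¹) * (gaussVortexProfile x / (2 * kerWeight ‖x‖)) * (fderiv ℝ (fun y => w y + kerWeight ‖y‖ * ∫ z, w z * ((2 * π)⁻¹ * Real.log ‖y - z‖)) x (perp x)) ^ 2 := by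
    refine ((contDiff_gaussWeightChi a).continuous.mul ?_).mul
      (((hu1.continuous_fderiv one_ne_zero).clm_apply continuous_perp).pow 2)
    exact (contDiff_gaussVortexProfile (n := 0)).continuous.div (continuous_const.mul
      (continuous_kerWeight.comp continuous_norm)) fun x => mul_ne_zero two_ne_zero (kerWeight_pos _).ne'
  have hexp3 : ∀ x : EuclideanSpace ℝ (Fin 2), Real.exp (a / 4 * ‖x‖ ^ 2) * Real.exp (-(‖x‖ ^ 2 / 4)) * Real.exp (-(‖x‖ ^ 2 / 4)) =
      Real.exp ((a - 2) / 4 * ‖x‖ ^ 2) := fun x => by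
    rw [← Real.exp_add, ← Real.exp_add]; ring_nf
  refine integrable_of_norm_le_poly_mul_gauss (C := (8 * π)⁻¹ * Cu ^ 2) (N := 14) hc.aestronglyMeasurable hμ
    fun x => ?_
  obtain ⟨-, hu'⟩ := hCu x
  obtain ⟨hχ0, hχ1, -, -⟩ := chi_bounds x
  obtain ⟨hΩ0, hΩ⟩ := gaussVortexProfile_div_two_mul_kerWeight_le x
  have hθ : |fderiv ℝ (fun y => w y + kerWeight ‖y‖ * ∫ z, w z * ((2 * π)⁻¹ * Real.log ‖y - z‖)) x (perp x)| ≤ Cu * (1 + ‖x‖) ^ 6 * Real.exp (-(‖x‖ ^ 2 / 4)) * (1 + ‖x‖) := by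
    rw [← Real.norm_eq_abs]
    refine (ContinuousLinearMap.le_opNorm _ _).trans ?_
    rw [norm_perp]
    exact mul_le_mul hu' (by linarith [norm_nonneg x]) (norm_nonneg _) (by positivity)
  have hθ2 : (fderiv ℝ (fun y => w y + kerWeight ‖y‖ * ∫ z, w z * ((2 * π)⁻¹ * Real.log ‖y - z‖)) x (perp x)) ^ 2 ≤ (Cu * (1 + ‖x‖) ^ 6 * Real.exp (-(‖x‖ ^ 2 / 4)) * (1 + ‖x‖)) ^ 2 := by
    rw [← sq_abs (fderiv ℝ (fun y => w y + kerWeight ‖y‖ * ∫ z, w z * ((2 * π)⁻¹ * Real.log ‖y - z‖)) x (perp x))]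
    exact pow_le_pow_left₀ (abs_nonneg _) hθ 2
  rw [Real.norm_of_nonneg (by positivity)]
  calc (Real.exp (a / 4 * ‖x‖ ^ 2) * (1 + ‖x‖ ^ 2)⁻¹) * (gaussVortexProfile x / (2 * kerWeight ‖x‖)) * (fderiv ℝ (fun y => w y + kerWeight ‖y‖ * ∫ z, w z * ((2 * π)⁻¹ * Real.log ‖y - z‖)) x (perp x)) ^ 2
      ≤ (Real.exp (a / 4 * ‖x‖ ^ 2) * 1) * (8 * π)⁻¹ * (Cu * (1 + ‖x‖) ^ 6 * Real.exp (-(‖x‖ ^ 2 / 4)) * (1 + ‖x‖)) ^ 2 := by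
        gcongr
    _ = (8 * π)⁻¹ * Cu ^ 2 * (1 + ‖x‖) ^ 14 * (Real.exp (a / 4 * ‖x‖ ^ 2) * Real.exp (-(‖x‖ ^ 2 / 4)) *
        Real.exp (-(‖x‖ ^ 2 / 4))) := by ring
    _ = _ := by rw [hexp3]

/-- **The multiplier identity**: testing `αΛw = L_λw − f` against `pχ∂_θu` gives
`α ∫ pχΩ(∂_θu)² = ∫ pχ ∂_θw L_λw − ∫ pχ V L_λw − ∫ pχ ∂_θu f`. [cite: Maekawa2009b, Prop. 4.2] -/
theorem mul_integral_gaussWeightChi_omega_sq_eq (ha2 : a < 2) (lam α : ℝ) :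
    α * ∫ x, (Real.exp (a / 4 * ‖x‖ ^ 2) * (1 + ‖x‖ ^ 2)⁻¹) * (gaussVortexProfile x / (2 * kerWeight ‖x‖)) * (fderiv ℝ (fun y => w y + kerWeight ‖y‖ * ∫ z, w z * ((2 * π)⁻¹ * Real.log ‖y - z‖)) x (perp x)) ^ 2 =
      (∫ x, (Real.exp (a / 4 * ‖x‖ ^ 2) * (1 + ‖x‖ ^ 2)⁻¹) * fderiv ℝ w x (perp x) * strainedVorticityOperator lam w x) - (∫ x, (Real.exp (a / 4 * ‖x‖ ^ 2) * (1 + ‖x‖ ^ 2)⁻¹) * (kerWeight ‖x‖ * ⟪biotSavart2D w x, x⟫) * strainedVorticityOperator lam w x) -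
        ∫ x, (Real.exp (a / 4 * ‖x‖ ^ 2) * (1 + ‖x‖ ^ 2)⁻¹) * fderiv ℝ (fun y => w y + kerWeight ‖y‖ * ∫ z, w z * ((2 * π)⁻¹ * Real.log ‖y - z‖)) x (perp x) * (strainedVorticityOperator lam w x - α * (⟪gaussVortexVelocity x, gradient w x⟫ + ⟪biotSavart2D w x, gradient gaussVortexProfile x⟫)) := by
  have hw1 : ContDiff ℝ 1 w := hw.of_le one_le_two
  have hu1 := contDiff_one_corrected hw hwc
  have hFc := (contDiff_gaussWeightChi a).continuous
  have hθc : Continuous fun x => fderiv ℝ (fun y => w y + kerWeight ‖y‖ * ∫ z, w z * ((2 * π)⁻¹ * Real.log ‖y - z‖)) x (perp x) := (hu1.continuous_fderiv one_ne_zero).clm_apply continuous_perp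
  have hθwc : Continuous fun x => fderiv ℝ w x (perp x) := (contDiff_one_angular hw).continuous
  have hVc := (contDiff_one_correctionV hw hwc).continuous
  have hAc := continuous_strainedVorticityOperator_of_contDiff_two hw lam
  have hAs := hasCompactSupport_strainedVorticityOperator hw hwc lam
  have hΛ : ∀ x, (⟪gaussVortexVelocity x, gradient w x⟫ + ⟪biotSavart2D w x, gradient gaussVortexProfile x⟫) = (gaussVortexProfile x / (2 * kerWeight ‖x‖)) * fderiv ℝ (fun y => w y + kerWeight ‖y‖ * ∫ z, w z * ((2 * π)⁻¹ * Real.log ‖y - z‖)) x (perp x) := gaussLambda_eq_omega_mul_fderiv_corrected_perp hw hwc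
  have iQ := integrable_gaussWeightChi_omega_mul_sq hw hwc ha2
  have iA : Integrable fun x => (Real.exp (a / 4 * ‖x‖ ^ 2) * (1 + ‖x‖ ^ 2)⁻¹) * fderiv ℝ (fun y => w y + kerWeight ‖y‖ * ∫ z, w z * ((2 * π)⁻¹ * Real.log ‖y - z‖)) x (perp x) * strainedVorticityOperator lam w x := integrable_mul_of_hasCompactSupport' (hFc.mul hθc) hAc hAs
  have iW : Integrable fun x => (Real.exp (a / 4 * ‖x‖ ^ 2) * (1 + ‖x‖ ^ 2)⁻¹) * fderiv ℝ w x (perp x) * strainedVorticityOperator lam w x := integrable_mul_of_hasCompactSupport' (hFc.mul hθwc) hAc hAs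
  have iV : Integrable fun x => (Real.exp (a / 4 * ‖x‖ ^ 2) * (1 + ‖x‖ ^ 2)⁻¹) * (kerWeight ‖x‖ * ⟪biotSavart2D w x, x⟫) * strainedVorticityOperator lam w x := integrable_mul_of_hasCompactSupport' (hFc.mul hVc) hAc hAs
  have h1 : ∫ x, (Real.exp (a / 4 * ‖x‖ ^ 2) * (1 + ‖x‖ ^ 2)⁻¹) * fderiv ℝ (fun y => w y + kerWeight ‖y‖ * ∫ z, w z * ((2 * π)⁻¹ * Real.log ‖y - z‖)) x (perp x) * (strainedVorticityOperator lam w x - α * (⟪gaussVortexVelocity x, gradient w x⟫ + ⟪biotSavart2D w x, gradient gaussVortexProfile x⟫)) = (∫ x, (Real.exp (a / 4 * ‖x‖ ^ 2) * (1 + ‖x‖ ^ 2)⁻¹) * fderiv ℝ (fun y => w y + kerWeight ‖y‖ * ∫ z, w z * ((2 * π)⁻¹ * Real.log ‖y - z‖)) x (perp x) * strainedVorticityOperator lam w x) - α * ∫ x, (Real.exp (a / 4 * ‖x‖ ^ 2) * (1 + ‖x‖ ^ 2)⁻¹) * (gaussVortexProfile x / (2 * kerWeight ‖x‖)) * (fderiv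 ℝ (fun y => w y + kerWeight ‖y‖ * ∫ z, w z * ((2 * π)⁻¹ * Real.log ‖y - z‖)) x (perp x)) ^ 2 := by
    rw [← integral_const_mul, ← integral_sub iA (iQ.const_mul α)]
    refine integral_congr_ae (Eventually.of_forall fun x => ?_)
    simp only [hΛ x]
    ring
  have h2 : ∫ x, (Real.exp (a / 4 * ‖x‖ ^ 2) * (1 + ‖x‖ ^ 2)⁻¹) * fderiv ℝ (fun y => w y + kerWeight ‖y‖ * ∫ z, w z * ((2 * π)⁻¹ * Real.log ‖y - z‖)) x (perp x) * strainedVorticityOperator lam w x = (∫ x, (Real.exp (a / 4 * ‖x‖ ^ 2) * (1 + ‖x‖ ^ 2)⁻¹) * fderiv ℝ w x (perp x) * strainedVorticityOperator lam w x) - ∫ x, (Real.exp (a / 4 * ‖x‖ ^ 2) * (1 + ‖x‖ ^ 2)⁻¹) * (kerWeight ‖x‖ * ⟪biotSavart2D w x, x⟫) * strainedVorticityOperator lam w x := by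
    rw [← integral_sub iW iV]
    refine integral_congr_ae (Eventually.of_forall fun x => ?_)
    simp only [fderiv_corrected_perp_eq hw hwc x]
    ring
  linarith

/-- **The `f`-term**: `|∫ pχ ∂_θu f| ≤ √(4∫p|∇w|² + 2C₁∫pw²) √(∫ p f²)` given the potential bound
`∫ pΦ²|v|² ≤ C₁ ∫ p w²` and the integrability of `p f²`. [folklore] -/
theorem abs_integral_gaussWeightChi_corrected_mul_rhs_le (lam α : ℝ) {C₁ : ℝ}
    (h4 : Integrable (fun x => Real.exp (a / 4 * ‖x‖ ^ 2) * kerWeight ‖x‖ ^ 2 * ‖biotSavart2D w x‖ ^ 2) ∧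
      ∫ x, Real.exp (a / 4 * ‖x‖ ^ 2) * kerWeight ‖x‖ ^ 2 * ‖biotSavart2D w x‖ ^ 2 ≤ C₁ * ∫ x, Real.exp (a / 4 * ‖x‖ ^ 2) * w x ^ 2)
    (hNf : Integrable fun x => Real.exp (a / 4 * ‖x‖ ^ 2) * (strainedVorticityOperator lam w x - α * (⟪gaussVortexVelocity x, gradient w x⟫ + ⟪biotSavart2D w x, gradient gaussVortexProfile x⟫)) ^ 2) :
    |∫ x, (Real.exp (a / 4 * ‖x‖ ^ 2) * (1 + ‖x‖ ^ 2)⁻¹) * fderiv ℝ (fun y => w y + kerWeight ‖y‖ * ∫ z, w z * ((2 * π)⁻¹ * Real.log ‖y - z‖)) x (perp x) * (strainedVorticityOperator lam w x - α * (⟪gaussVortexVelocity x, gradient w x⟫ + ⟪biotSavart2D w x, gradient gaussVortexProfile x⟫))| ≤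
      Real.sqrt (4 * (∫ x, Real.exp (a / 4 * ‖x‖ ^ 2) * (fderiv ℝ w x (EuclideanSpace.single 0 1) ^ 2 + fderiv ℝ w x (EuclideanSpace.single 1 1) ^ 2)) + 2 * (C₁ * ∫ x, Real.exp (a / 4 * ‖x‖ ^ 2) * w x ^ 2)) * Real.sqrt (∫ x, Real.exp (a / 4 * ‖x‖ ^ 2) * (strainedVorticityOperator lam w x - α * (⟪gaussVortexVelocity x, gradient w x⟫ + ⟪biotSavart2D w x, gradient gaussVortexProfile x⟫)) ^ 2) := by
  have hw1 : ContDiff ℝ 1 w := hw.of_le one_le_two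
  have hu1 := contDiff_one_corrected hw hwc
  have hpc : Continuous fun x : EuclideanSpace ℝ (Fin 2) => Real.exp (a / 4 * ‖x‖ ^ 2) := (contDiff_gaussWeightExp a (n := 0)).continuous
  have hθc : Continuous fun x => fderiv ℝ (fun y => w y + kerWeight ‖y‖ * ∫ z, w z * ((2 * π)⁻¹ * Real.log ‖y - z‖)) x (perp x) := (hu1.continuous_fderiv one_ne_zero).clm_apply continuous_perp
  have hχc : Continuous fun x : EuclideanSpace ℝ (Fin 2) => (1 + ‖x‖ ^ 2)⁻¹ :=
    (continuous_const.add (continuous_norm.pow 2)).inv₀ fun x => (by positivity : (0:ℝ) < 1 + ‖x‖ ^ 2).ne'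
  have hAc := continuous_strainedVorticityOperator_of_contDiff_two hw lam
  have hΛc := continuous_gaussLambda hw hwc
  have hdc : ∀ i : Fin 2, Continuous (fun y => fderiv ℝ w y (EuclideanSpace.single i 1)) := fun i => (hw1.continuous_fderiv one_ne_zero).clm_apply continuous_const
  have hds : ∀ i : Fin 2, HasCompactSupport (fun y => fderiv ℝ w y (EuclideanSpace.single i 1)) := fun i => hwc.fderiv_apply (𝕜 := ℝ) _
  have hvc : Continuous (biotSavart2D w) := (contDiff_biotSavart2D hw1 hwc).continuous
  have iX : ∀ i : Fin 2, Integrable fun x : EuclideanSpace ℝ (Fin 2) => Real.exp (a / 4 * ‖x‖ ^ 2) * fderiv ℝ w x (EuclideanSpace.single i 1) ^ 2 := by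
    intro i
    have : Integrable fun x : EuclideanSpace ℝ (Fin 2) => Real.exp (a / 4 * ‖x‖ ^ 2) * fderiv ℝ w x (EuclideanSpace.single i 1) * fderiv ℝ w x (EuclideanSpace.single i 1) :=
      integrable_mul_of_hasCompactSupport' (hpc.mul (hdc i)) (hdc i) (hds i)
    exact this.congr (Eventually.of_forall fun x => by beta_reduce; ring)
  have iX01 : Integrable fun x : EuclideanSpace ℝ (Fin 2) => Real.exp (a / 4 * ‖x‖ ^ 2) * (fderiv ℝ w x (EuclideanSpace.single 0 1) ^ 2 + fderiv ℝ w x (EuclideanSpace.single 1 1) ^ 2) := by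
    have : Integrable fun x : EuclideanSpace ℝ (Fin 2) => Real.exp (a / 4 * ‖x‖ ^ 2) * fderiv ℝ w x (EuclideanSpace.single 0 1) ^ 2 + Real.exp (a / 4 * ‖x‖ ^ 2) * fderiv ℝ w x (EuclideanSpace.single 1 1) ^ 2 := (iX 0).add (iX 1)
    exact this.congr (Eventually.of_forall fun x => by beta_reduce; ring)
  -- pointwise `P (χ∂_θu)² ≤ 4P|∇w|² + 2PΦ²|v|²`
  have hpt : ∀ x : EuclideanSpace ℝ (Fin 2), Real.exp (a / 4 * ‖x‖ ^ 2) * ((1 + ‖x‖ ^ 2)⁻¹ * fderiv ℝ (fun y => w y + kerWeight ‖y‖ * ∫ z, w z * ((2 * π)⁻¹ * Real.log ‖y - z‖)) x (perp x)) ^ 2 ≤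
      4 * (Real.exp (a / 4 * ‖x‖ ^ 2) * (fderiv ℝ w x (EuclideanSpace.single 0 1) ^ 2 + fderiv ℝ w x (EuclideanSpace.single 1 1) ^ 2)) + 2 * (Real.exp (a / 4 * ‖x‖ ^ 2) * kerWeight ‖x‖ ^ 2 * ‖biotSavart2D w x‖ ^ 2) := by
    intro x
    obtain ⟨hχ0, hχ1, hχ2, hχ3⟩ := chi_bounds x
    have hP0 : 0 < Real.exp (a / 4 * ‖x‖ ^ 2) := Real.exp_pos _
    have hΦ0 : 0 ≤ kerWeight ‖x‖ := (kerWeight_pos _).le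
    rw [fderiv_corrected_perp_eq hw hwc x]
    have hθb := abs_angular_le (w := w) x
    have hvx : |⟪biotSavart2D w x, x⟫| ≤ ‖biotSavart2D w x‖ * ‖x‖ := abs_real_inner_le_norm _ _
    set χ := (1 + ‖x‖ ^ 2)⁻¹ with hχ
    set d0 := fderiv ℝ w x (EuclideanSpace.single 0 1)
    set d1 := fderiv ℝ w x (EuclideanSpace.single 1 1)
    have e1 : |χ * fderiv ℝ w x (perp x)| ≤ |d0| + |d1| := by
      rw [abs_mul, abs_of_pos hχ0]
      calc χ * |fderiv ℝ w x (perp x)| ≤ χ * (‖x‖ * (|d0| + |d1|)) := mul_le_mul_of_nonneg_left hθb hχ0.le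
        _ = (χ * ‖x‖) * (|d0| + |d1|) := by ring
        _ ≤ 1 * (|d0| + |d1|) := by gcongr
        _ = _ := one_mul _
    have e2 : |χ * (kerWeight ‖x‖ * ⟪biotSavart2D w x, x⟫)| ≤ kerWeight ‖x‖ * ‖biotSavart2D w x‖ := by
      rw [abs_mul, abs_mul, abs_of_pos hχ0, abs_of_nonneg hΦ0]
      calc χ * (kerWeight ‖x‖ * |⟪biotSavart2D w x, x⟫|) ≤ χ * (kerWeight ‖x‖ * (‖biotSavart2D w x‖ * ‖x‖)) := by gcongr
        _ = kerWeight ‖x‖ * ‖biotSavart2D w x‖ * (χ * ‖x‖) := by ring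
        _ ≤ kerWeight ‖x‖ * ‖biotSavart2D w x‖ * 1 := by gcongr
        _ = _ := mul_one _
    have e3 : (χ * (fderiv ℝ w x (perp x) - (kerWeight ‖x‖ * ⟪biotSavart2D w x, x⟫))) ^ 2 ≤ 2 * (χ * fderiv ℝ w x (perp x)) ^ 2 + 2 * (χ * (kerWeight ‖x‖ * ⟪biotSavart2D w x, x⟫)) ^ 2 := by
      nlinarith [sq_nonneg (χ * fderiv ℝ w x (perp x) + χ * (kerWeight ‖x‖ * ⟪biotSavart2D w x, x⟫))]
    have e4 : (χ * fderiv ℝ w x (perp x)) ^ 2 ≤ (|d0| + |d1|) ^ 2 := by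
      rw [← sq_abs (χ * _)]; exact pow_le_pow_left₀ (abs_nonneg _) e1 2
    have e5 : (χ * (kerWeight ‖x‖ * ⟪biotSavart2D w x, x⟫)) ^ 2 ≤ (kerWeight ‖x‖ * ‖biotSavart2D w x‖) ^ 2 := by
      rw [← sq_abs (χ * _)]; exact pow_le_pow_left₀ (abs_nonneg _) e2 2
    have e6 : (|d0| + |d1|) ^ 2 ≤ 2 * (d0 ^ 2 + d1 ^ 2) := by
      nlinarith [sq_nonneg (|d0| - |d1|), sq_abs d0, sq_abs d1]
    calc Real.exp (a / 4 * ‖x‖ ^ 2) * (χ * (fderiv ℝ w x (perp x) - (kerWeight ‖x‖ * ⟪biotSavart2D w x, x⟫))) ^ 2 ≤ Real.exp (a / 4 * ‖x‖ ^ 2) * (2 * (2 * (d0 ^ 2 + d1 ^ 2)) + 2 * (kerWeight ‖x‖ * ‖biotSavart2D w x‖) ^ 2) := by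
          refine mul_le_mul_of_nonneg_left ?_ hP0.le
          linarith
      _ = _ := by ring
  have hmaj : Integrable fun x => 4 * (Real.exp (a / 4 * ‖x‖ ^ 2) * (fderiv ℝ w x (EuclideanSpace.single 0 1) ^ 2 + fderiv ℝ w x (EuclideanSpace.single 1 1) ^ 2)) + 2 * (Real.exp (a / 4 * ‖x‖ ^ 2) * kerWeight ‖x‖ ^ 2 * ‖biotSavart2D w x‖ ^ 2) :=
    (iX01.const_mul 4).add (h4.1.const_mul 2)
  have iA : Integrable fun x => Real.exp (a / 4 * ‖x‖ ^ 2) * ((1 + ‖x‖ ^ 2)⁻¹ * fderiv ℝ (fun y => w y + kerWeight ‖y‖ * ∫ z, w z * ((2 * π)⁻¹ * Real.log ‖y - z‖)) x (perp x)) ^ 2 :=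
    hmaj.mono' (hpc.mul ((hχc.mul hθc).pow 2)).aestronglyMeasurable (Eventually.of_forall fun x => by
      rw [Real.norm_of_nonneg (by positivity)]; exact hpt x)
  have hA : ∫ x, Real.exp (a / 4 * ‖x‖ ^ 2) * ((1 + ‖x‖ ^ 2)⁻¹ * fderiv ℝ (fun y => w y + kerWeight ‖y‖ * ∫ z, w z * ((2 * π)⁻¹ * Real.log ‖y - z‖)) x (perp x)) ^ 2 ≤ 4 * (∫ x, Real.exp (a / 4 * ‖x‖ ^ 2) * (fderiv ℝ w x (EuclideanSpace.single 0 1) ^ 2 + fderiv ℝ w x (EuclideanSpace.single 1 1) ^ 2)) + 2 * (C₁ * ∫ x, Real.exp (a / 4 * ‖x‖ ^ 2) * w x ^ 2) := by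
    refine (integral_mono iA hmaj hpt).trans ?_
    rw [integral_add (iX01.const_mul 4) (h4.1.const_mul 2), integral_const_mul, integral_const_mul]
    linarith [h4.2]
  have hAm : Measurable fun x : EuclideanSpace ℝ (Fin 2) => (1 + ‖x‖ ^ 2)⁻¹ * fderiv ℝ (fun y => w y + kerWeight ‖y‖ * ∫ z, w z * ((2 * π)⁻¹ * Real.log ‖y - z‖)) x (perp x) := (hχc.mul hθc).measurable
  have hBm : Measurable fun x : EuclideanSpace ℝ (Fin 2) => (strainedVorticityOperator lam w x - α * (⟪gaussVortexVelocity x, gradient w x⟫ + ⟪biotSavart2D w x, gradient gaussVortexProfile x⟫)) := (hAc.sub (continuous_const.mul hΛc)).measurable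
  have h := abs_integral_gaussWeight_mul_mul_le_sqrt (fun x => (Real.exp_pos _).le) hpc.measurable hAm hBm iA hNf
  have heq : ∫ x, Real.exp (a / 4 * ‖x‖ ^ 2) * ((1 + ‖x‖ ^ 2)⁻¹ * fderiv ℝ (fun y => w y + kerWeight ‖y‖ * ∫ z, w z * ((2 * π)⁻¹ * Real.log ‖y - z‖)) x (perp x)) * (strainedVorticityOperator lam w x - α * (⟪gaussVortexVelocity x, gradient w x⟫ + ⟪biotSavart2D w x, gradient gaussVortexProfile x⟫)) = ∫ x, (Real.exp (a / 4 * ‖x‖ ^ 2) * (1 + ‖x‖ ^ 2)⁻¹) * fderiv ℝ (fun y => w y + kerWeight ‖y‖ * ∫ z, w z * ((2 * π)⁻¹ * Real.log ‖y - z‖)) x (perp x) * (strainedVorticityOperator lam w x - α * (⟪gaussVortexVelocity x, gradient w x⟫ + ⟪biotSavart2D w x, gradient gaussVortexProfile x⟫)) :=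
    integral_congr_ae (Eventually.of_forall fun x => by beta_reduce; ring)
  rw [heq] at h
  exact h.trans (mul_le_mul_of_nonneg_right (Real.sqrt_le_sqrt hA) (Real.sqrt_nonneg _))

end Identity

/-- The potential bound for `v` with weight `p‖DΦ‖²` (uniform constant). [folklore] -/
theorem exists_gaussWeight_fderivKer_velocity_bound {lam : ℝ} (hlam0 : 0 ≤ lam) (hlam1 : lam < 1) :
    ∃ C₃, 0 ≤ C₃ ∧ ∀ g : EuclideanSpace ℝ (Fin 2) → ℝ, Continuous g → HasCompactSupport g →
      Integrable (fun x => Real.exp ((1 - lam) / 4 * ‖x‖ ^ 2) * ‖fderiv ℝ (fun y : EuclideanSpace ℝ (Fin 2) => kerWeight ‖y‖) x‖ ^ 2 * ‖biotSavart2D g x‖ ^ 2) ∧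
      ∫ x, Real.exp ((1 - lam) / 4 * ‖x‖ ^ 2) * ‖fderiv ℝ (fun y : EuclideanSpace ℝ (Fin 2) => kerWeight ‖y‖) x‖ ^ 2 * ‖biotSavart2D g x‖ ^ 2 ≤
        C₃ * ∫ x, Real.exp ((1 - lam) / 4 * ‖x‖ ^ 2) * g x ^ 2 := by
  have ha0 : 0 ≤ 1 - lam := by linarith
  have ha2 : 1 - lam < 2 := by linarith
  have hβ : 0 < (2 - (1 - lam)) / 4 / 2 := by linarith
  have hc8 : 0 < (1 - lam) / 8 := by linarith
  have hW₃c : Continuous fun x : EuclideanSpace ℝ (Fin 2) => Real.exp ((1 - lam) / 4 * ‖x‖ ^ 2) * ‖fderiv ℝ (fun y : EuclideanSpace ℝ (Fin 2) => kerWeight ‖y‖) x‖ ^ 2 :=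
    (contDiff_gaussWeightExp (1 - lam) (n := 0)).continuous.mul
      ((contDiff_kerWeight_norm.continuous_fderiv one_ne_zero).norm.pow 2)
  obtain ⟨K₃, -, hK₃⟩ := exists_gaussWeight_norm_fderiv_kerWeight_sq_le ha2
  obtain ⟨D, hD0, hD⟩ := exists_integral_mul_norm_sq_biotSavart2D_le hW₃c (fun x => by positivity) hK₃ hβ hc8
  refine ⟨D, hD0, fun g hg hgc => ?_⟩
  obtain ⟨i, b⟩ := hD g hg hgc
  obtain ⟨-, hqp⟩ := integral_exp_eighth_mul_sq_le ha0 hg hgc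
  exact ⟨i, b.trans (mul_le_mul_of_nonneg_left hqp hD0)⟩

/-- Scalar bookkeeping for `asymBurgers_angular_smallness`. [folklore] -/
private theorem angular_bookkeeping {a CE C' Nw Nf X2 Mr W Vv Ff Q : ℝ}
    (hCE : 0 ≤ CE) (hNw : 0 ≤ Nw) (hNf : 0 ≤ Nf) (hMr : 0 ≤ Mr)
    (hE : X2 + Mr ≤ CE * (Nw + Nf)) (hW : W ≤ (a + 8) * X2)
    (hV : Vv ≤ (3 * ((a / 2 + 3) ^ 2 + 1) * C' + C' + (C' + 1) / 2) * Nw + (3 * C' + 2) * X2)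
    (hF : Ff ≤ (4 * X2 + 2 * (C' * Nw) + Nf) / 2) (hQ : Q ≤ W + Vv + Ff) (ha : 0 ≤ a) (hC' : 0 ≤ C') :
    Q ≤ (((a + 8) + (3 * C' + 2) + 2) * CE + (3 * ((a / 2 + 3) ^ 2 + 1) * C' + C' + (C' + 1) / 2) + C' + 1) *
      (Nw + Nf) := by
  have hX2 : X2 ≤ CE * (Nw + Nf) := by linarith
  have h1 : ((a + 8) + (3 * C' + 2) + 2) * X2 ≤ ((a + 8) + (3 * C' + 2) + 2) * (CE * (Nw + Nf)) :=
    mul_le_mul_of_nonneg_left hX2 (by positivity)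
  have h2 : 0 ≤ (3 * ((a / 2 + 3) ^ 2 + 1) * C' + C' + (C' + 1) / 2) * Nf := by positivity
  have h3 : 0 ≤ C' * Nf := by positivity
  have h4 : 0 ≤ CE * (Nw + Nf) := by positivity
  nlinarith

/-- **Angular smallness at large rotation (Maekawa 2009, the quantitative core of Lemma 4.1).**
For `0 ≤ λ < 1` there is `C` such that for all `α` and all `C²` compactly supported `w`,
with `p = e^{(1-λ)|x|²/4}`, `u = w + Φ (N ∗ w)`, `Ω = G/(2Φ)` and
`f = (L + λM)w − αΛw`,
`|α| ∫ p (1+|x|²)⁻¹ Ω (∂_θu)² ≤ C (∫ p w² + ∫ p f²)`.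
This is the multiplier estimate obtained by testing the equation against `pχ∂_θu` and using the
skew identity `Λw = Ω ∂_θu` [cite: GallayMaekawa2016, §4.1 (4.5)] together with the uniform energy
bound. [cite: Maekawa2009b, §4 Lemma 4.1 and Prop. 4.2] -/
theorem asymBurgers_angular_smallness {lam : ℝ} (hlam0 : 0 ≤ lam) (hlam1 : lam < 1) :
    ∃ C, 0 ≤ C ∧ ∀ (α : ℝ) (w : EuclideanSpace ℝ (Fin 2) → ℝ), ContDiff ℝ 2 w → HasCompactSupport w →
      |α| * ∫ x, (Real.exp ((1 - lam) / 4 * ‖x‖ ^ 2) * (1 + ‖x‖ ^ 2)⁻¹) * (gaussVortexProfile x / (2 * kerWeight ‖x‖)) * (fderiv ℝ (fun y => w y + kerWeight ‖y‖ * ∫ z, w z * ((2 * π)⁻¹ * Real.log ‖y - z‖)) x (perp x)) ^ 2 ≤ C * ((∫ x, Real.exp ((1 - lam) / 4 * ‖x‖ ^ 2) * w x ^ 2) + ∫ x, Real.exp ((1 - lam) / 4 * ‖x‖ ^ 2) * (strainedVorticityOperator lam w x - α * (⟪gaussVortexVelocity x, gradient w x⟫ + ⟪biotSavart2D w x, gradient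 gaussVortexProfile x⟫)) ^ 2) := by
  have ha0 : 0 ≤ 1 - lam := by linarith
  have ha2 : 1 - lam < 2 := by linarith
  obtain ⟨CE, hCE0, hEB⟩ := asymBurgers_uniform_energy_bound hlam0 hlam1
  obtain ⟨C₁, hC₁0, hPB⟩ := exists_gaussWeight_potential_bounds hlam0 hlam1
  obtain ⟨C₃, hC₃0, hVB⟩ := exists_gaussWeight_fderivKer_velocity_bound hlam0 hlam1
  have hC'0 : 0 ≤ C₁ + C₃ := add_nonneg hC₁0 hC₃0
  refine ⟨(((1 - lam) + 8) + (3 * (C₁ + C₃) + 2) + 2) * CE +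
    (3 * (((1 - lam) / 2 + 3) ^ 2 + 1) * (C₁ + C₃) + (C₁ + C₃) + ((C₁ + C₃) + 1) / 2) + (C₁ + C₃) + 1,
    by positivity, fun α w hw hwc => ?_⟩
  have hw1 : ContDiff ℝ 1 w := hw.of_le one_le_two
  have hdc : ∀ i : Fin 2, Continuous (fun y => fderiv ℝ w y (EuclideanSpace.single i 1)) := fun i =>
    (hw1.continuous_fderiv one_ne_zero).clm_apply continuous_const
  have hds : ∀ i : Fin 2, HasCompactSupport (fun y => fderiv ℝ w y (EuclideanSpace.single i 1)) := fun i => hwc.fderiv_apply (𝕜 := ℝ) _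
  have hN0 : 0 ≤ ∫ x, Real.exp ((1 - lam) / 4 * ‖x‖ ^ 2) * w x ^ 2 := integral_nonneg fun x => by positivity
  have hNf0 : 0 ≤ ∫ x, Real.exp ((1 - lam) / 4 * ‖x‖ ^ 2) * (strainedVorticityOperator lam w x - α * (⟪gaussVortexVelocity x, gradient w x⟫ + ⟪biotSavart2D w x, gradient gaussVortexProfile x⟫)) ^ 2 := integral_nonneg fun x => by positivity
  have hM0 : 0 ≤ ∫ x, Real.exp ((1 - lam) / 4 * ‖x‖ ^ 2) * (‖x‖ ^ 2 * w x ^ 2) := integral_nonneg fun x => by positivity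
  have hX0 : ∀ i : Fin 2, 0 ≤ ∫ x, Real.exp ((1 - lam) / 4 * ‖x‖ ^ 2) * fderiv ℝ w x (EuclideanSpace.single i 1) ^ 2 := fun i => integral_nonneg fun x => by positivity
  have hQ0 : 0 ≤ ∫ x, (Real.exp ((1 - lam) / 4 * ‖x‖ ^ 2) * (1 + ‖x‖ ^ 2)⁻¹) * (gaussVortexProfile x / (2 * kerWeight ‖x‖)) * (fderiv ℝ (fun y => w y + kerWeight ‖y‖ * ∫ z, w z * ((2 * π)⁻¹ * Real.log ‖y - z‖)) x (perp x)) ^ 2 := integral_nonneg fun x => by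
    have := (gaussVortexProfile_div_two_mul_kerWeight_le x).1
    positivity
  -- potential bounds with the common constant `C₁ + C₃`
  obtain ⟨-, -, -, h4⟩ := hPB w hw.continuous hwc
  have h4' : Integrable (fun x => Real.exp ((1 - lam) / 4 * ‖x‖ ^ 2) * kerWeight ‖x‖ ^ 2 * ‖biotSavart2D w x‖ ^ 2) ∧
      ∫ x, Real.exp ((1 - lam) / 4 * ‖x‖ ^ 2) * kerWeight ‖x‖ ^ 2 * ‖biotSavart2D w x‖ ^ 2 ≤ (C₁ + C₃) * ∫ x, Real.exp ((1 - lam) / 4 * ‖x‖ ^ 2) * w x ^ 2 :=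
    ⟨h4.1, h4.2.trans (by nlinarith)⟩
  have h5 := hVB w hw.continuous hwc
  have h5' : Integrable (fun x => Real.exp ((1 - lam) / 4 * ‖x‖ ^ 2) * ‖fderiv ℝ (fun y : EuclideanSpace ℝ (Fin 2) => kerWeight ‖y‖) x‖ ^ 2 * ‖biotSavart2D w x‖ ^ 2) ∧
      ∫ x, Real.exp ((1 - lam) / 4 * ‖x‖ ^ 2) * ‖fderiv ℝ (fun y : EuclideanSpace ℝ (Fin 2) => kerWeight ‖y‖) x‖ ^ 2 * ‖biotSavart2D w x‖ ^ 2 ≤ (C₁ + C₃) * ∫ x, Real.exp ((1 - lam) / 4 * ‖x‖ ^ 2) * w x ^ 2 :=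
    ⟨h5.1, h5.2.trans (by nlinarith)⟩
  have h6' : ∀ i : Fin 2, Integrable (fun x => Real.exp ((1 - lam) / 4 * ‖x‖ ^ 2) * kerWeight ‖x‖ ^ 2 * ‖biotSavart2D (fun y => fderiv ℝ w y (EuclideanSpace.single i 1)) x‖ ^ 2) ∧
      ∫ x, Real.exp ((1 - lam) / 4 * ‖x‖ ^ 2) * kerWeight ‖x‖ ^ 2 * ‖biotSavart2D (fun y => fderiv ℝ w y (EuclideanSpace.single i 1)) x‖ ^ 2 ≤ (C₁ + C₃) * ∫ x, Real.exp ((1 - lam) / 4 * ‖x‖ ^ 2) * fderiv ℝ w x (EuclideanSpace.single i 1) ^ 2 := by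
    intro i
    obtain ⟨-, -, -, h6⟩ := hPB (fun y => fderiv ℝ w y (EuclideanSpace.single i 1)) (hdc i) (hds i)
    have := hX0 i
    exact ⟨h6.1, h6.2.trans (by nlinarith)⟩
  -- the four estimates
  obtain ⟨iNf, hE⟩ := hEB α w hw hwc
  have hW := abs_integral_gaussWeightChi_angular_mul_strained_le hw hwc ha0 hlam0 hlam1.le
  have hV := abs_integral_gaussWeightChi_correctionV_mul_strained_le hw hwc ha0 hlam0 hlam1.le hC'0 h4' h5' h6'
  have hF := abs_integral_gaussWeightChi_corrected_mul_rhs_le hw hwc lam α h4' iNf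
  have hId := mul_integral_gaussWeightChi_omega_sq_eq hw hwc ha2 lam α
  have hX20 : 0 ≤ ∫ x, Real.exp ((1 - lam) / 4 * ‖x‖ ^ 2) * (fderiv ℝ w x (EuclideanSpace.single 0 1) ^ 2 + fderiv ℝ w x (EuclideanSpace.single 1 1) ^ 2) := integral_nonneg fun x => by positivity
  have hF' := hF.trans (sqrt_mul_sqrt_le_half _ _ (by positivity) hNf0)
  have hQ : |α| * ∫ x, (Real.exp ((1 - lam) / 4 * ‖x‖ ^ 2) * (1 + ‖x‖ ^ 2)⁻¹) * (gaussVortexProfile x / (2 * kerWeight ‖x‖)) * (fderiv ℝ (fun y => w y + kerWeight ‖y‖ * ∫ z, w z * ((2 * π)⁻¹ * Real.log ‖y - z‖)) x (perp x)) ^ 2 ≤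
      |∫ x, (Real.exp ((1 - lam) / 4 * ‖x‖ ^ 2) * (1 + ‖x‖ ^ 2)⁻¹) * fderiv ℝ w x (perp x) * strainedVorticityOperator lam w x| + |∫ x, (Real.exp ((1 - lam) / 4 * ‖x‖ ^ 2) * (1 + ‖x‖ ^ 2)⁻¹) * (kerWeight ‖x‖ * ⟪biotSavart2D w x, x⟫) * strainedVorticityOperator lam w x| + |∫ x, (Real.exp ((1 - lam) / 4 * ‖x‖ ^ 2) * (1 + ‖x‖ ^ 2)⁻¹) * fderiv ℝ (fun y => w y + kerWeight ‖y‖ * ∫ z, w z * ((2 * π)⁻¹ * Real.log ‖y - z‖)) x (perp x) * (strainedVorticityOperator lam w x - α * (⟪gaussVortexVelocity x, gradient w x⟫ + ⟪biotSavart2D w x, gradient gaussVortexProfile x⟫))| := by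
    rw [← abs_of_nonneg hQ0, ← abs_mul, hId]
    exact (abs_sub _ _).trans (add_le_add_left (abs_sub _ _) _)
  exact angular_bookkeeping hCE0 hN0 hNf0 hM0 hE hW hV hF' hQ ha0 hC'0

end Literature.Analysis.FluidPDE
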